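import Summits.QuantumFields.YangMills.Theorems.BalabanUVNodesN06AtRecord11ObligationsPins
import Summits.QuantumFields.YangMills.Theorems.BalabanUVNodesN06AtRecord11ObligationsHg
import Summits.QuantumFields.YangMills.Theorems.BalabanUVNodesN06SectBOfFrameV4
import Literature.MathematicalPhysics.QuantumFieldTheory.Balaban1983to89.B9Cor35ComparisonsEH
import Literature.MathematicalPhysics.QuantumFieldTheory.Balaban1983to89.B9Ineq344LocalPairHolds
import Literature.MathematicalPhysics.QuantumFieldTheory.Balaban1983to89.B9Ineq347GAAtLetters
import Literature.MathematicalPhysics.QuantumFieldTheory.Balaban1983to89.B9Thm39ReadingAtLetters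
import Literature.MathematicalPhysics.QuantumFieldTheory.Balaban1983to89.B9Thm314Thm315RecordVacuity
import Literature.MathematicalPhysics.QuantumFieldTheory.Balaban1983to89.Node00.OpsYSectDE
import Literature.MathematicalPhysics.QuantumFieldTheory.Balaban1983to89.B9Thm312WholeLeafRelH
import Literature.MathematicalPhysics.QuantumFieldTheory.Balaban1983to89.B9Thm313WholeLeafRel
import Literature.MathematicalPhysics.QuantumFieldTheory.Balaban1983to89.B9Thm312WholeFacesY
import Literature.MathematicalPhysics.QuantumFieldTheory.Balaban1983to89.B9CarrierBlockMultiplicity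
import Literature.MathematicalPhysics.QuantumFieldTheory.Balaban1983to89.B9CoRealizesRelAtLetters
import Literature.MathematicalPhysics.QuantumFieldTheory.Balaban1983to89.B9Ineq349SiteReading
import Literature.MathematicalPhysics.QuantumFieldTheory.Balaban1983to89.B9Eq3132AtRecordDE
import Literature.MathematicalPhysics.QuantumFieldTheory.Balaban1983to89.B9Thm314Thm315RecordDE
import Literature.MathematicalPhysics.QuantumFieldTheory.Balaban1983to89.B9Thm311ReadingAtLetters
import Literature.MathematicalPhysics.QuantumFieldTheory.Balaban1983to89.B9RWSumsDefinitePinsPair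
import Summits.QuantumFields.YangMills.Theorems.BalabanUVNodesN06CoReadingsOfPins
import Literature.MathematicalPhysics.QuantumFieldTheory.Balaban1983to89.B9Eq3132NuReading
import Literature.MathematicalPhysics.QuantumFieldTheory.Balaban1983to89.Node00.OpsYRecordV5
import Literature.MathematicalPhysics.QuantumFieldTheory.Balaban1983to89.B9Thm311PosAtRecordV4
import Literature.MathematicalPhysics.QuantumFieldTheory.Balaban1983to89.B9CoReadingCoordsH
import Literature.MathematicalPhysics.QuantumFieldTheory.Balaban1983to89.B9Ineq349SiteFromBlocks
import Literature.MathematicalPhysics.QuantumFieldTheory.Balaban1983to89.Node00.OpsYRecordV4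
import Literature.MathematicalPhysics.QuantumFieldTheory.Balaban1983to89.B9Thm315WholeSectERepOn

/-!
# BalabanUVNodes ∕ N06 ([B9], `Dag.B9_main`) — THE STAGE-11 CERTIFICATE AT `opsYNuOfRecordV4E N θ₃ M⋆ 𝔯 (sectEYOfRecordV5 N θ₃ M⋆ 𝔢₀) 𝔴 𝔈` ON n06-k's PAIR FACE,
# WITH EVERY (3.42) ∕ (3.47) ∕ (3.133) CO-READING AND THE G-SIDE (3.46) LINES 0–2 PROVED ON THE COORDINATE MODELS OF THE GENUINE LETTERS

Track A of `YM-PLAN.md` (cell `pub-ymgap`, HUMAN RULING D-0062), node **N06** = [Balaban1985BackgroundPropagators] Thms 3.1–3.15; seat `pub-ymgap-dag-n06-d` gen 5.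
Successor of `…N06AtOpsYNuOfRecordV5ECoords` (p514159): the 28-row composition `N06AtRecord11CB10YZW.b9_main_of_up_view₁₁B10YZW_of_obligations` at n06-i's
row-26-repaired instance `B9Eq3132NuReading.opsYNuOfRecordV4E` taken at def-Y g5's v5 Sect. E letters of record `Node00.sectEYOfRecordV5 … 𝔢₀` (all four outer letters
`μ ∕ D̄ ∕ μ* ∕ D̄*` of (3.185) genuine), with THREE upgrades:
* rows 13∕18∕19 ⇐ n06-k g8's PAIR face `B9RWSumsDefinitePinsPair.rows131819_definite_geo9Y_pair` (p515044): the second-order (3.46) members in def-Y's K-index order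
  (3 = mixed ∇O∇* on the one-slot letter, 4 = ∇∇O and 5 = O∇*∇* on print's PAIR FAMILIES `familyOp …` over direction letters `𝔡 ∕ 𝔡A : DirOps37 ∕ DirOps310`, schemas
  `L2SecondLegs ∕ FactorsL2Second ∕ DirTranspose`, pair primitives `p3 q3 : PairPrims`, `NQ`) — the (O5) K-index caveat of the Nbr-face certificates is CURED; definite
  E-letters `E37YPair ∕ E310YPair`;
* rows 20–21's FOUR (3.133) co-readings `hcoHR12` PROVED: the Thm-3.12∕3.13 walk letters' input carrier is `XHK κK x.toKIdx` (coarse point × slots), block map pinned to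
  `blkHK`, models `Hm ∕ H1m` pinned to `HcoK … (𝔏 x).H ∕ .H₁ U` (n06-d `B9CoReadingCoordsH`, p515210: `coRealizesHRel_of_pins`);
* row 13 from ONE `F : SectBFrame₄ …` (n06-c g5 `N06SectBOfFrameV4.hB_obligation_of_sectBFrame₄`, p514352: all six (3.46) member-steps of G′(U′U) are theorems on the
  letters; nine G-side member-steps displayed inside the frame).
Unchanged from p514159: ROW 26 from four Λ-normalised CT binders (`s3132Nu_opsYNuOfRecordV4E`); ROW 24 through the (3.185) slot with the outer locality PROVED
(`localOuterY_sectEYOfRecordV5`); ROW 17 from the pin + ONE clause `hΔA` (n06-j `t311_of_pins_opsYOfLettersV4₁`); row 11 no binder (n06-h); rows 20–23 on n06-l ∕ n06-m faces;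
row 25 on n06-i's `stmt349Printed_site_of_blockSchemas`; rows 15–16 n06-j; the G′ walk letters on `XSK κK x.toKIdx`, the G and Thm-3.12∕3.13 letters on `XBK κK x.toKIdx`,
block maps pinned through the carrier-∕level-∕1-faithful `bI` (inhabited at every member: n06-k `B9IndexBondFaithful.exists_faithful_kIdx`; displayed because the walk
letters are pinned to it); all 43 (3.42)∕(3.47) co-readings + the G-side L² lines 0–2 by `N06CoReadingsOfPins` (p512666).
Still displayed (the node's content): every walk-expansion schema; the `L2ReadsNbr` lines G′ 0–5 ∕ G 3–5, `H1ReadsNbr`, `InputReadsNbr` — of which, per n06-k's LOCATED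
(O4′) (INBOX l.18078), `hl3 hlA3` (mixed member on the ONE-SLOT composite `D ∘ₗ (G ∘ₗ Dstar)`, diagonal pairs only) and the (3.44)∕(3.45) halves of `hIR hIRA` are NOT
dischargeable at one-slot pins (cure: n06-k's v4 `…PairM` generation); `mN hnbr` (n06-i g10 `B9GeoNbrCountKLevelV1` offers the count above an M⋆-threshold); the four
(3.132) binders; `F`; rows 15–16 ∕ 22–25 inputs.
HONEST FRAMING.  Kernel bookkeeping; COUNT-NEUTRAL; NOT a discharge claim (Theorem 3.1's estimates for Bałaban's operators at U ≠ 1 are nowhere proved — they are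
the displayed walk-expansion schemas ABOUT the genuine operators in real coordinates); N06 NOT discharged.  One finite 𝕋⁴ programme at fixed `ε` — NOT ℝ⁴ ∕ OS ∕
mass gap ∕ Clay.  0 `def`, 0 `sorry`.
-/

noncomputable section

namespace Summit.QuantumFields.YangMills.BalabanUVNodes.N06AtOpsYNuOfRecordV5EPair

open Literature.MathematicalPhysics.QuantumFieldTheory.Balaban1983to89 open Literature.MathematicalPhysics.QuantumFieldTheory.Balaban1983to89.T4Continuum (T4Family) open Literature.MathematicalPhysics.QuantumFieldTheory.Balaban1983to89.DagBinding (WorldP leavesP) open Literature.MathematicalPhysics.QuantumFieldTheory.Balaban1983to89.Node00 open Literature.MathematicalPhysics.QuantumFieldTheory.Balaban1983to89.B9PinMembersKLevelV1 (MemberY geo9Y bg9Y) open Literature.MathematicalPhysics.QuantumFieldTheory.Balaban1983to89.B9PinGeometryKLevelV1 (dOmegaY OmKY inΛY unitDistY InCubeY c35Y c35Y_pos) open Literature.MathematicalPhysics.QuantumFieldTheory.Balaban1983to89.B7Prop2SpecialUnitary (specialUnitaryUnits specialUnitaryUnits_le_unitaryUnits) open Literature.MathematicalPhysics.QuantumFieldTheory.Balaban1983to89.B9Ineq347GAAtLetters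 (hGA_opsYOfLetters) open Literature.MathematicalPhysics.QuantumFieldTheory.Balaban1983to89.B9Ineq344LocalPairHolds (hGp_opsYOfLetters_holds) open Literature.MathematicalPhysics.QuantumFieldTheory.Balaban1983to89.B9Cor35ComparisonsGAAtLetters
  (hGA_e_opsYOfLetters hGA_h1_opsYOfLetters hGA_e4_opsYOfLetters hGA_h2_opsYOfLetters hGA_l2_opsYOfLetters)
open Literature.MathematicalPhysics.QuantumFieldTheory.Balaban1983to89.B9Cor35ComparisonsGpCAtLetters (hGp_e_opsYOfLetters hGp_h1_opsYOfLetters hC_opsYOfLetters) open Literature.MathematicalPhysics.QuantumFieldTheory.Balaban1983to89.B9Cor35ComparisonsEH (hE4_of_hGA_e4 hH2_of_hGA_h2) open Literature.MathematicalPhysics.QuantumFieldTheory.Balaban1983to89.B9Thm314Thm315RecordVacuity (thm315FullPrinted_of_ker_zero) open Literature.MathematicalPhysics.QuantumFieldTheory.Balaban1983to89.B9RecordDELettersVacuity (siteKernelOfOp_zero_ker fineKernelOfOp_zero_ker stmt349Printed_of_ker_zero) open Literature.MathematicalPhysics.QuantumFieldTheory.Balaban1983to89.B9GeoLemma21KLevelV1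 (geo9Y_len_pos) open Literature.MathematicalPhysics.QuantumFieldTheory.Balaban1983to89.B9Thm311Whole (PosDefOfOps) open Literature.MathematicalPhysics.QuantumFieldTheory.Balaban1983to89.B9Thm39Whole (WalkReading39) open Literature.MathematicalPhysics.QuantumFieldTheory.Balaban1983to89.B9Thm39WholeBlk (Ops39Blk StaticOK39Blk Locality39Blk Local348Blk Identities395Blk Small285Blk Factors389Blk)
open Literature.MathematicalPhysics.QuantumFieldTheory.Balaban1983to89.B9Thm39WholeBlkViaDatum (EK39OfOpsBlkVia) open Literature.MathematicalPhysics.QuantumFieldTheory.Balaban1983to89.B9Thm39ReadingCoords (repSite39) open Literature.MathematicalPhysics.QuantumFieldTheory.Balaban1983to89.B9Thm39ReadingAtLetters (X39 blk39 L39 t39_hksum_of_pins_opsYOfLetters) open Literature.MathematicalPhysics.QuantumFieldTheory.Balaban1983to89.B9RowSum261DefiniteFaces (rowConst261) open Summit.QuantumFields.YangMills.BalabanUVNodes.N06AtRecord11ObligationsPins (t311_of_pin) open Summit.QuantumFields.YangMills.BalabanUVNodes.N06AtRecord11ObligationsHg (hg_obligation_vacuous) open Summit.QuantumFields.YangMills.BalabanUVNodes.N06AtRecord11CB10YZW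 (b9_main_of_up_view₁₁B10YZW_of_obligations) open Literature.MathematicalPhysics.QuantumFieldTheory.Balaban1983to89.B9Thm312Whole (GeoOK Thm33G0 FormSmall HasRWExpOfOps HasRWExpHOfOps PosDefKOfOps) open Literature.MathematicalPhysics.QuantumFieldTheory.Balaban1983to89.B11SectG (RowSum BlockNorm) open Literature.MathematicalPhysics.QuantumFieldTheory.Balaban1983to89.B9FromB6 (L2Block) open Literature.MathematicalPhysics.QuantumFieldTheory.Balaban1983to89.B9Thm312WholeH (LettersH) open Literature.MathematicalPhysics.QuantumFieldTheory.Balaban1983to89.B9Thm312WholeLeft (LeftStep)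
open Literature.MathematicalPhysics.QuantumFieldTheory.Balaban1983to89.B9Thm313WholeLeft (Letters313D) open Literature.MathematicalPhysics.QuantumFieldTheory.Balaban1983to89.B9Thm313Whole (Letters313) open Literature.MathematicalPhysics.QuantumFieldTheory.Balaban1983to89.B9Ineq347CoReading (CoReadsGlob) open Literature.MathematicalPhysics.QuantumFieldTheory.Balaban1983to89.B9Thm312WholeFacesY (lemma21AboveG_geo9Y) open Literature.MathematicalPhysics.QuantumFieldTheory.Balaban1983to89.B9GeoNormsKLevelV1 (geo9K_dist_nonneg) open Literature.MathematicalPhysics.QuantumFieldTheory.Balaban1983to89.B9GeoLemma21KLevelV1 (distOK_geo9Y rowSum261_geo9Y geo9Y_dist_triangle geo9Y_dist_comm) open Literature.MathematicalPhysics.QuantumFieldTheory.Balaban1983to89.B9GeoNormsKLevelModelSignsV1 (modelSignsOn_geo9K) open Literature.MathematicalPhysics.QuantumFieldTheory.Balaban1983to89.B9Thm34Ext (toB6) open Literature.MathematicalPhysics.QuantumFieldTheory.Balaban1983to89.B9CoRealizesRel (CoRealizesRel) open Literature.MathematicalPhysics.QuantumFieldTheory.Balaban1983to89.B9CoRealizesRelAtLetters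 (RelB maj342_relB_left maj342_relB_right dist_eq_of_relB len_eq_of_relB relB_refl)
open Literature.MathematicalPhysics.QuantumFieldTheory.Balaban1983to89.B9CoRealizesHRel (CoRealizesHRel) open Literature.MathematicalPhysics.QuantumFieldTheory.Balaban1983to89.B9SectCDiffDict (maj342) open Literature.MathematicalPhysics.QuantumFieldTheory.Balaban1983to89.B6Ineq2142KLevelV1 (β) open Literature.MathematicalPhysics.QuantumFieldTheory.Balaban1983to89.B9CarrierBlockMultiplicity (card_sameCarrier_le_kIdx) open Literature.MathematicalPhysics.QuantumFieldTheory.Balaban1983to89.B9Thm312WholeLeafRelH (thm312Printed_of_stepRelH) open Literature.MathematicalPhysics.QuantumFieldTheory.Balaban1983to89.B9Thm313WholeLeafRel (thm313Printed_of_stepRel) open Literature.MathematicalPhysics.QuantumFieldTheory.Balaban1983to89.B9Eq3132SectDLetters (QGQY) open Literature.MathematicalPhysics.QuantumFieldTheory.Balaban1983to89.B9Eq3132CTInputs (CoerciveUnder DecayUnder) open Literature.MathematicalPhysics.QuantumFieldTheory.Balaban1983to89.B9Eq3132ScalarIndex (geoComap) open Literature.MathematicalPhysics.QuantumFieldTheory.Balaban1983to89.B9Eq3132RingInverseReading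 (normMatY) open Literature.MathematicalPhysics.QuantumFieldTheory.Balaban1983to89.B9Ineq349SiteReading (opsYS349OfRecordDE) open Literature.MathematicalPhysics.QuantumFieldTheory.Balaban1983to89.B9Eq3132AtRecordDE (s3132_opsYOfRecordDE)
open Literature.MathematicalPhysics.QuantumFieldTheory.Balaban1983to89.B9Thm314Thm315RecordDE (thm314_pair_opsYOfRecordDE t315_opsYOfRecordDE_of_slots) open Literature.MathematicalPhysics.QuantumFieldTheory.Balaban1983to89.B9Thm311ReadingAtLetters (ops311Y) open Literature.MathematicalPhysics.QuantumFieldTheory.Balaban1983to89.B9Thm311ReadingCoords (PosDefTr) open Literature.MathematicalPhysics.QuantumFieldTheory.Balaban1983to89.B9Thm311SymmAtRecordV4 (proofLettersOneV4) open Literature.MathematicalPhysics.QuantumFieldTheory.Balaban1983to89.B9Thm311PosAtRecordV4 (t311_of_pins_opsYOfLettersV4₁) open Literature.MathematicalPhysics.QuantumFieldTheory.Balaban1983to89.B9PinGeometryKLevelV1 (kLab) open Literature.MathematicalPhysics.QuantumFieldTheory.Balaban1983to89.B9Thm314GpFlatTorusGeometry (tdistK OmegaC) open Literature.MathematicalPhysics.QuantumFieldTheory.Balaban1983to89.B9Thm314WholePinGeometry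 (locDataY) open Literature.MathematicalPhysics.QuantumFieldTheory.Balaban1983to89.B9Thm314WholePair (locData₂) open Literature.MathematicalPhysics.QuantumFieldTheory.Balaban1983to89.B9Thm314WholePairWalks (pairWalkSets) open Literature.MathematicalPhysics.QuantumFieldTheory.Balaban1983to89.B9Thm314WholeSummation (WalkSetsSpec WalkWeightsSummable) open Literature.MathematicalPhysics.QuantumFieldTheory.Balaban1983to89.B9SectCWalkTermsAllNorms (Thm310AllNormsPrinted) open Literature.MathematicalPhysics.QuantumFieldTheory.Balaban1983to89.B9Thm314WholeExpansionReads (ExpansionReads) open Literature.MathematicalPhysics.QuantumFieldTheory.Balaban1983to89.B9Thm314WholeCancellationLayer (pairOp) open Literature.MathematicalPhysics.QuantumFieldTheory.Balaban1983to89.B9Thm37Whole (Ops Sizes StaticOK Local342 Identities)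
open Literature.MathematicalPhysics.QuantumFieldTheory.Balaban1983to89.B9Cor38Whole (WalkReading Locality) open Literature.MathematicalPhysics.QuantumFieldTheory.Balaban1983to89.B9Thm310Whole (Ops310 WalkReading310 Sizes310 StaticOK310 Locality310 Local342G Identities310) open Literature.MathematicalPhysics.QuantumFieldTheory.Balaban1983to89.B9RWSumsDefinitePins (PinPrims) open Literature.MathematicalPhysics.QuantumFieldTheory.Balaban1983to89.B9RWSumsDefinitePinsPair (PairPrims E37YPair E310YPair rows131819_definite_geo9Y_pair) open Literature.MathematicalPhysics.QuantumFieldTheory.Balaban1983to89.B9RWSums346SecondDiff (familyOp DirOps310 DirTranspose310 L2SecondLegs310 FactorsL2Second310) open Literature.MathematicalPhysics.QuantumFieldTheory.Balaban1983to89.B9RWSums346SecondDiffGp (DirOps37 DirTranspose37 L2SecondLegs37 FactorsL2Second37) open Literature.MathematicalPhysics.QuantumFieldTheory.Balaban1983to89.B9Thm37Glue (IsTransposePair) open Literature.MathematicalPhysics.QuantumFieldTheory.Balaban1983to89.B9RWSums343to347Whole (GlobReads) open Literature.MathematicalPhysics.QuantumFieldTheory.Balaban1983to89.B9RWSumsReadsNbr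 (nbr L2ReadsNbr H1ReadsNbr InputReadsNbr) open Literature.MathematicalPhysics.QuantumFieldTheory.Balaban1983to89.B9RWSums346Two (L2TwoLegs310 FactorsL2_310) open Literature.MathematicalPhysics.QuantumFieldTheory.Balaban1983to89.B9RWSums346TwoGp (L2TwoLegs37 FactorsL2_37) open Literature.MathematicalPhysics.QuantumFieldTheory.Balaban1983to89.B9RWSums344Input (InputLegs310 FactorsInput310)
open Literature.MathematicalPhysics.QuantumFieldTheory.Balaban1983to89.B9RWSums344InputGp (InputLegs37 FactorsInput37) open Literature.MathematicalPhysics.QuantumFieldTheory.Balaban1983to89.B9RWSums343Holder (HolderProbes HolderLegs310 FactorsHolder310) open Literature.MathematicalPhysics.QuantumFieldTheory.Balaban1983to89.B9RWSums343HolderGp (HolderLegs37 HolderV37) open Literature.MathematicalPhysics.QuantumFieldTheory.Balaban1983to89.B9SectBStepFrameV4 (SectBFrame₄) open Summit.QuantumFields.YangMills.BalabanUVNodes.N06SectBOfFrameV4 (hB_obligation_of_sectBFrame₄)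
open Literature.MathematicalPhysics.QuantumFieldTheory.Balaban1983to89.B9CoReadingCoords (XBK evBK blkBK GcoK DcoK DscoK LcoK) open Literature.MathematicalPhysics.QuantumFieldTheory.Balaban1983to89.B9CoReadingCoordsS (XSK evSK blkSK sIK GcoS DcoS DscoS LcoS) open Summit.QuantumFields.YangMills.BalabanUVNodes.N06CoReadingsOfPins (bond_coReadings3_of_pins bond_coReadingsLap_of_pins site_coReadings4_of_pins bond_l2ReadsNbr3_of_pins) open Literature.MathematicalPhysics.QuantumFieldTheory.Balaban1983to89.B6Geom246MultiLevelTorus (geomT)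
open Literature.MathematicalPhysics.QuantumFieldTheory.Balaban1983to89.B9Eq3132NuReading (opsYNuOfRecordV4E opsYS349NuOfLetters lamInvY s3132Nu_opsYNuOfRecordV4E) open Literature.MathematicalPhysics.QuantumFieldTheory.Balaban1983to89.B9CoReadingCoordsH (XHK blkHK HcoK coRealizesHRel_of_pins)
open Literature.MathematicalPhysics.QuantumFieldTheory.Balaban1983to89.B9Ineq349SiteFromBlocks (Thm31SiteSchemas Thm32BlkSchema stmt349Printed_site_of_blockSchemas) open Literature.MathematicalPhysics.QuantumFieldTheory.Balaban1983to89.B6GlobalChartV1 (blkV1) open Literature.MathematicalPhysics.QuantumFieldTheory.Balaban1983to89.B6Ineq2142KLevelV1 (lvl) open Literature.MathematicalPhysics.QuantumFieldTheory.Balaban1983to89.B9Thm315WholeSectERep (LocalOuterY) open Literature.MathematicalPhysics.QuantumFieldTheory.Balaban1983to89.B9Thm315WholeSectERepOn (DecayMidOnY t315_opsYSectE_of_3185_on) open Literature.MathematicalPhysics.QuantumFieldTheory.Balaban1983to89.B9Thm314WholeCancellationLayer (thm314_pair_layerOfLetters) open Literature.MathematicalPhysics.QuantumFieldTheory.Balaban1983to89.B9Thm314WholePinGeometry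 (locDataY_laws) open Literature.MathematicalPhysics.QuantumFieldTheory.Balaban1983to89.B9PinGeometryKLevelV1 (dOmegaY_nonneg) open scoped Matrix.Norms.L2Operator

variable {N : ℕ}

section Pointed

variable [NeZero N] {F : T4Family}

/-- **THE STAGE-11 CERTIFICATE AT `opsYNuOfRecordV4E N θ M⋆ 𝔯 (sectEYOfRecordV5 N θ M⋆ 𝔢₀) 𝔴 𝔈` ON THE PAIR FACE** (module docstring): the 28-row composition
at def-Y's v5 instance of record with n06-i's ν-read (3.132) fields — rows 13∕18∕19 on n06-k's Pair face (K-index order of record, print's pair families for the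
second-order members), rows 20–21 with the (3.133) co-readings PROVED on the H-coordinate model, row 13 from one `F : SectBFrame₄`, row 26 from the four Λ-normalised
binders, row 24 with the outer locality proved, row 17 one clause, row 11 no binder, every (3.42)∕(3.47) co-reading and the G-side L² lines 0–2 theorems.  NOT a
discharge of N06. [cite: Balaban1985BackgroundPropagators, Thms 3.1–3.15 pp.397–432, (3.39)–(3.42) p.397, (3.46)–(3.47) p.398, (3.49) p.399, (3.126) p.420, (3.132)–(3.133)
p.422, (3.168)–(3.169) p.430, (3.185)–(3.187) p.432; Balaban1984PropagatorsII, (2.45) p.231, (2.51)–(2.54) pp.232–233, Lemma 2.1 (2.60)–(2.61) pp.233–234, (2.142) p.248,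
Prop. 2.7 (2.149)–(2.150) p.249] -/
theorem b9_main_of_up_view₁₁B10YZW_opsYNuOfRecordV5E_pair
    (θ : Stage11Params F N) (hθ : θ.Admissible) (Mstar : ℕ) (𝔯 : ResY N θ.toStage3Params Mstar) (𝔢₀ : SectEY N θ.toStage3Params Mstar) (𝔴 : RWEY N θ.toStage3Params Mstar) (𝔈 : ExpsY N θ.toStage3Params Mstar) (ζ : ResidZ F N) (lamW : ResidW F N) (w : WorldP)
    (hup : ∀ P, w.up P = upOfRecord₅C F N (θ.view₁₁B10YZW F N Mstar (opsYNuOfRecordV4E N θ.toStage3Params Mstar 𝔯 (sectEYOfRecordV5 N θ.toStage3Params Mstar 𝔢₀) 𝔴 𝔈) ζ lamW) P) [∀ x : MemberY θ.d₆ θ.ℓ₆ θ.hd' θ.hL' θ.b₀ θ.b₁ Mstar, Fintype (geo9Y x).Site] [∀ x : MemberY θ.d₆ θ.ℓ₆ θ.hd' θ.hL' θ.b₀ θ.b₁ Mstar, DecidableEq (geo9Y x).Site]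
    -- the carrier-block equivalence `RelB` of the record is decidable (any instance; `Classical.decRel` or the blocks' `DecidableEq`)
    [∀ x : MemberY θ.d₆ θ.ℓ₆ θ.hd' θ.hL' θ.b₀ θ.b₁ Mstar, DecidableRel (RelB x.toKIdx)]
    -- the κ-fold coordinate data of the instance (n06-d `B9CoReadingCoords`): a real basis of M_N(ℂ) and a block map on the fine bonds, carrier- and level-faithful
    -- and 1-faithful (ONE such map exists at every member: n06-k `B9IndexBondFaithful.exists_faithful_kIdx` = hlev ∧ hβI ∧ hβ1; displayed because the walk letters are pinned to it)
    {κK : Type} [Fintype κK] [DecidableEq κK] (bK : Module.Basis κK ℝ (Matrix (Fin N) (Fin N) ℂ)) (bI : ∀ x : MemberY θ.d₆ θ.ℓ₆ θ.hd' θ.hL' θ.b₀ θ.b₁ Mstar, FBondY x.toKIdx → IBondY x.toKIdx)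
    (hβI : ∀ (x : MemberY θ.d₆ θ.ℓ₆ θ.hd' θ.hL' θ.b₀ θ.b₁ Mstar) (f : FBondY x.toKIdx) (c : IBondY x.toKIdx), blkV1 x.hN x.D f = β x.hN x.D x.hk c → β x.hN x.D x.hk (bI x f) = blkV1 x.hN x.D f)
    (hlev : ∀ (x : MemberY θ.d₆ θ.ℓ₆ θ.hd' θ.hL' θ.b₀ θ.b₁ Mstar) (f : FBondY x.toKIdx), lvl x.hN x.D x.hk (bI x f) = (blkV1 x.hN x.D f).1.1)
    (hβ1 : ∀ (x : MemberY θ.d₆ θ.ℓ₆ θ.hd' θ.hL' θ.b₀ θ.b₁ Mstar) (f : FBondY x.toKIdx), (geomT x.D).dist (β x.hN x.D x.hk (bI x f)) (blkV1 x.hN x.D f) ≤ 1)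
    -- row 11 has NO binder: n06-h g5 `B9Ineq344LocalPairHolds.hGp_opsYOfLetters_holds` (the located residual schema of (3.44)∕(3.45) at U = 1 is a theorem)
    -- row 13 on n06-c g4's frame OF RECORD `SectBFrame₃` (`N06SectBOfFrameV3.hB_obligation_of_sectBFrame₃`, p506914∕p508689): [B9] Sect. B (3.50)–(3.69) — Lemma-2.1 fields,
    -- the L² readings∕writings of its own `KernelFamily.l2`, and ELEVEN displayed positive-input block-steps (G′ members 3, 5; the six G members; (3.43)–(3.45) of G)
    [∀ x : MemberY θ.d₆ θ.ℓ₆ θ.hd' θ.hL' θ.b₀ θ.b₁ Mstar, Nonempty (geo9Y x).Site] {ιB κB : Type} [Fintype ιB] [DecidableEq ιB] [Fintype κB] [LinearOrder κB] (bB : Module.Basis ιB ℝ (Matrix (Fin N) (Fin N) ℂ)) (SB : MemberY θ.d₆ θ.ℓ₆ θ.hd' θ.hL' θ.b₀ θ.b₁ Mstar → Type) [∀ x, Fintype (SB x)]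
    [∀ x, DecidableEq (SB x)]
    (F : SectBFrame₄ c35Y geo9Y (bg9Y (Matrix (Fin N) (Fin N) ℂ) (specialUnitaryUnits (Fin N))) (fun x => ((opsYNuOfRecordV4E N θ.toStage3Params Mstar 𝔯 (sectEYOfRecordV5 N θ.toStage3Params Mstar 𝔢₀) 𝔴 𝔈) x).Gp) bB κB SB (fun x => ((opsYNuOfRecordV4E N θ.toStage3Params Mstar 𝔯 (sectEYOfRecordV5 N θ.toStage3Params Mstar 𝔢₀) 𝔴 𝔈) x).GA) (fun x => ((opsYNuOfRecordV4E N θ.toStage3Params Mstar 𝔯 (sectEYOfRecordV5 N θ.toStage3Params Mstar 𝔢₀) 𝔴 𝔈) x).Cinv) (fun x => ((opsYNuOfRecordV4E N θ.toStage3Params Mstar 𝔯 (sectEYOfRecordV5 N θ.toStage3Params Mstar 𝔢₀) 𝔴 𝔈) x).IsAnalyticExt))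
    (hdB : F.dB = θ.d₆ + 1)
    -- rows 15–16: Theorem 3.9's carrier letters on the block carrier `X39`, read by `rd39`; printed-shape schemas; the three pins (n06-j g5)
    {ι39 κ39 : MemberY θ.d₆ θ.ℓ₆ θ.hd' θ.hL' θ.b₀ θ.b₁ Mstar → Type} [∀ x, Fintype (ι39 x)] (𝔬39 : ∀ x : MemberY θ.d₆ θ.ℓ₆ θ.hd' θ.hL' θ.b₀ θ.b₁ Mstar, Ops39Blk (geo9Y x) (bg9Y (Matrix (Fin N) (Fin N) ℂ) (specialUnitaryUnits (Fin N)) x) (X39 (Matrix (Fin N) (Fin N) ℂ) x.toKIdx) (ι39 x) (κ39 x))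
    (rd39 : ∀ x : MemberY θ.d₆ θ.ℓ₆ θ.hd' θ.hL' θ.b₀ θ.b₁ Mstar, WalkReading39 (bg9Y (Matrix (Fin N) (Fin N) ℂ) (specialUnitaryUnits (Fin N)) x) (ι39 x) (κ39 x)) (α39 α' r39 δ39 θ39 B39 N39 a39 M39 : ℝ) (h39α : 0 < α39) (h39α1 : α39 < 1) (hα'0 : 0 < α') (hα'1 : α' < 1) (hr39 : 0 < r39)
    (hrδ39 : r39 ≤ δ39) (hθ39 : 0 ≤ θ39) (hB39 : 0 < B39) (hN39 : 0 ≤ N39) (ha39 : 0 < a39) (hM39 : 0 < M39) (hst39 : ∀ x, StaticOK39Blk (𝔬39 x) N39) (hloc39 : ∀ x, Locality39Blk (𝔬39 x) (rd39 x))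
    (h39 : ∀ x : MemberY θ.d₆ θ.ℓ₆ θ.hd' θ.hL' θ.b₀ θ.b₁ Mstar, M39 ≤ (geo9Y x).M → ∀ α₀ : ℝ, 0 < α₀ → c35Y * (geo9Y x).M * α₀ ≤ a39 → ∀ U : (bg9Y (Matrix (Fin N) (Fin N) ℂ) (specialUnitaryUnits (Fin N)) x).Cfg, (bg9Y (Matrix (Fin N) (Fin N) ℂ) (specialUnitaryUnits (Fin N)) x).Reg335 c35Y α₀ U →
      Local348Blk (𝔬39 x) B39 δ39 U ∧ Identities395Blk (𝔬39 x) U ∧ Small285Blk (𝔬39 x) θ39 r39 U ∧ Factors389Blk (𝔬39 x) θ39 δ39 U)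
    (hblk39 : ∀ x, (𝔬39 x).blk = blk39 (Matrix (Fin N) (Fin N) ℂ) x.toKIdx) (hL39 : ∀ x, (𝔬39 x).L = L39 x.toKIdx (lettersYOfRecordV4 N θ.toStage3Params Mstar 𝔯 x).parS (lettersYOfRecordV4 N θ.toStage3Params Mstar 𝔯 x).Gp)
    (hEK39 : ∀ x : MemberY θ.d₆ θ.ℓ₆ θ.hd' θ.hL' θ.b₀ θ.b₁ Mstar, ((opsYNuOfRecordV4E N θ.toStage3Params Mstar 𝔯 (sectEYOfRecordV5 N θ.toStage3Params Mstar 𝔢₀) 𝔴 𝔈) x).EK39 = EK39OfOpsBlkVia (𝔬39 x) (rd39 x) (θ.d₆ + 1) (2 * (N39 * B39) * rowConst261 (geo9Y (d := θ.d₆) (ℓ := θ.ℓ₆) (hd := θ.hd') (hL := θ.hL') (b₀ := θ.b₀) (b₁ := θ.b₁) (Mstar :=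
      Mstar)) (α' * r39)) ((1 - α') * r39) (repSite39 x.toKIdx))
    -- row 17 on n06-j g7's face OF RECORD `B9Thm311PosAtRecordV4.t311_of_pins_opsYOfLettersV4₁` (p511749): Theorem 3.11 from the pin `hPD` at the parametrix letters
    -- `proofLettersOneV4` (G₀ := G(U), R := 0) and ONE displayed clause — the positivity of def-Y's GENUINE Δ_a(U) on (3.35) (= [B9] Thms 3.3∕3.10's analytic content,
    -- G-B9-06); `pos0 symm0 adj qps_inj symmG` and the inverse identities are THEOREMS (n06-j `B9Thm311DeltaPrimePos`: Δ′_a(U) > 0 for every SU(N)-valued U)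
    (a311 M311 : ℝ) (ha311 : 0 < a311) (hM311 : 0 < M311)
    (hΔA : ∀ x : MemberY θ.d₆ θ.ℓ₆ θ.hd' θ.hL' θ.b₀ θ.b₁ Mstar, M311 ≤ (geo9Y x).M → ∀ α₀ : ℝ, 0 < α₀ → (geo9Y x).M * α₀ ≤ a311 → ∀ U : (bg9Y (Matrix (Fin N) (Fin N) ℂ) (specialUnitaryUnits (Fin N)) x).Cfg, (bg9Y (Matrix (Fin N) (Fin N) ℂ) (specialUnitaryUnits (Fin N)) x).Reg335 c35Y α₀ U →
      PosDefTr (fun _ => (1 : ℝ)) (deltaAY x.toKIdx (parSymY x.toKIdx) (parBY x.toKIdx) (GpY x.toKIdx (parSymY x.toKIdx)) U))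
    (hPD : ∀ x : MemberY θ.d₆ θ.ℓ₆ θ.hd' θ.hL' θ.b₀ θ.b₁ Mstar, ((opsYNuOfRecordV4E N θ.toStage3Params Mstar 𝔯 (sectEYOfRecordV5 N θ.toStage3Params Mstar 𝔢₀) 𝔴 𝔈) x).PosDef = PosDefOfOps (ops311Y x (lettersYOfRecordV4 N θ.toStage3Params Mstar 𝔯 x) (proofLettersOneV4 θ.toStage3Params Mstar 𝔯 x)))
    -- rows 18–19 on n06-k g8's PAIR face `rows131819_definite_geo9Y_pair` (Thm 3.7 ∕ Cor. 3.8 ∕ Thm 3.10 + «the RW sums yield (3.42)–(3.47)» at the definite E-letters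
    -- `E37YPair`∕`E310YPair`, second-order members on pair families over direction letters `𝔡 𝔡A`): walk letters of G′(U) (free carriers `X Y`, evaluations `ev evY`) and of G(U) (PINNED on `XBK κK`, `evBK`), static∕locality schemas, Cor. 3.6's
    -- packages (posited, printed shape), the (3.46)∕(3.43)∕input co-readings in the Nbr species `L2ReadsNbr … 2 (Real.sqrt ((θ.d₆ + 1) * Fintype.card κK))` ∕ `H1ReadsNbr … 2` ∕ `InputReadsNbr … 2` (radius-2
    -- anchoring, constant `Cev = √((d+1)|κK|)` — the Rel species `L2ReadsRel` is REFUTED at the pinned `evBK`, n06-k `not_l2ReadsRel_evBK` p503700), transposes, support counts, the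
    -- two E-pins (K-index order of record: 3 = mixed one-slot, 4∕5 = pair families; (O4′) caveat on `hl3 hlA3` and the e4∕h2 halves of `hIR hIRA` — module docstring);
    -- `Rel := RelB`, `m := 2(d+1)`, `hRlen hRd₁ hRd₂ hmult` DISCHARGED at the record; `mN`, `Cev = √((d+1)|κK|)`, `hnbr` displayed
    {ι PX PY Q ιA AA PXA PYA QA : MemberY θ.d₆ θ.ℓ₆ θ.hd' θ.hL' θ.b₀ θ.b₁ Mstar → Type} [∀ x, Fintype (ι x)] [∀ x, Fintype (Q x)] [∀ x, Fintype (QA x)] [∀ x, Fintype (PX x)] [∀ x, DecidableEq (PX x)] [∀ x, Fintype (PY x)] [∀ x, DecidableEq (PY x)]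
    [∀ x, Fintype (ιA x)] [∀ x, Fintype (AA x)] [∀ x, Fintype (PXA x)] [∀ x, DecidableEq (PXA x)] [∀ x, Fintype (PYA x)] [∀ x, DecidableEq (PYA x)] (p q : PinPrims) (hp : p.OK) (hq : q.OK)
    (p3 q3 : PairPrims) (hp3 : p3.OK) (hq3 : q3.OK) (NQ : ℝ) (hNQ0 : 0 ≤ NQ) (H : MemberY θ.d₆ θ.ℓ₆ θ.hd' θ.hL' θ.b₀ θ.b₁ Mstar → Prop)
    (mN : ℕ) (hnbr : ∀ (x : MemberY θ.d₆ θ.ℓ₆ θ.hd' θ.hL' θ.b₀ θ.b₁ Mstar) (y : (geo9Y x).Site), (nbr (geo9Y x) 2 y).card ≤ mN)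
    (𝔬 : ∀ x : MemberY θ.d₆ θ.ℓ₆ θ.hd' θ.hL' θ.b₀ θ.b₁ Mstar, Ops (geo9Y x) (bg9Y (Matrix (Fin N) (Fin N) ℂ) (specialUnitaryUnits (Fin N)) x) (XSK κK x.toKIdx) (XSK κK x.toKIdx) (ι x))
    (rd : ∀ x : MemberY θ.d₆ θ.ℓ₆ θ.hd' θ.hL' θ.b₀ θ.b₁ Mstar, WalkReading (geo9Y x) (bg9Y (Matrix (Fin N) (Fin N) ℂ) (specialUnitaryUnits (Fin N)) x) (XSK κK x.toKIdx) (ι x))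
    (𝔭 : ∀ x : MemberY θ.d₆ θ.ℓ₆ θ.hd' θ.hL' θ.b₀ θ.b₁ Mstar, HolderProbes (geo9Y x) (bg9Y (Matrix (Fin N) (Fin N) ℂ) (specialUnitaryUnits (Fin N)) x) (XSK κK x.toKIdx) (XSK κK x.toKIdx) (PX x) (PY x))
    (𝔡 : ∀ x : MemberY θ.d₆ θ.ℓ₆ θ.hd' θ.hL' θ.b₀ θ.b₁ Mstar, DirOps37 (𝔬 x) (Q x)) (bH : ∀ x : MemberY θ.d₆ θ.ℓ₆ θ.hd' θ.hL' θ.b₀ θ.b₁ Mstar, ℝ → BlockNorm (toB6 (geo9Y x) 1 (H x)) (XSK κK x.toKIdx → ℝ))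
    (κ : MemberY θ.d₆ θ.ℓ₆ θ.hd' θ.hL' θ.b₀ θ.b₁ Mstar → Sizes)
    (SH S3 SI S2 : ∀ x : MemberY θ.d₆ θ.ℓ₆ θ.hd' θ.hL' θ.b₀ θ.b₁ Mstar, ι x → Finset (geo9Y x).Site) (hst : ∀ x, StaticOK (𝔬 x) p.ρ p.Nc p.N' p.Cℓ (κ x)) (hκ : ∀ x, (κ x).Bounded p.Kc p.θ₀ p.Cℓ (geo9Y x).M) (hrd : ∀ x, (rd x).OK (𝔬 x).blk) (hloc : ∀ x, Locality (𝔬 x) (rd x))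
    (h36 : ∀ x, p.M₁ ≤ (geo9Y x).M → ∀ α₀ : ℝ, 0 < α₀ → c35Y * (geo9Y x).M * α₀ ≤ p.a₁ → ∀ U : (bg9Y (Matrix (Fin N) (Fin N) ℂ) (specialUnitaryUnits (Fin N)) x).Cfg, (bg9Y (Matrix (Fin N) (Fin N) ℂ) (specialUnitaryUnits (Fin N)) x).Reg335 c35Y α₀ U → Local342 (𝔬 x) 1 (H x) p.B₀ p.δ₀ U ∧ Identities
      (𝔬 x) 1 (H x) U)
    (h36H : ∀ x, p.M₁ ≤ (geo9Y x).M → ∀ α₀ : ℝ, 0 < α₀ → c35Y * (geo9Y x).M * α₀ ≤ p.a₁ → ∀ U : (bg9Y (Matrix (Fin N) (Fin N) ℂ) (specialUnitaryUnits (Fin N)) x).Cfg, (bg9Y (Matrix (Fin N) (Fin N) ℂ) (specialUnitaryUnits (Fin N)) x).Reg335 c35Y α₀ U → HolderLegs37 (𝔬 x) (𝔭 x) 1 (H x) (SH x) p.Bl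
      p.δ₀ U ∧ HolderV37 (𝔬 x) (𝔭 x) 1 (H x) p.Bt p.δ₀ U ∧ (L2SecondLegs37 (𝔬 x) (𝔡 x) 1 (H x) (S3 x) p3.B3 p.δ₀ U ∧ FactorsL2Second37 (𝔬 x) (𝔡 x) 1 (H x) p3.θ3 p.δ₀ U ∧ DirTranspose37 (𝔬 x) (𝔡 x) U) ∧ InputLegs37 (𝔬 x) (𝔭 x) 1 (H x) (bH x) (SI x) p.BI p.BI2 p.δ₀ U ∧ FactorsInput37 (𝔬 x) 1 (H x) (bH x) p.θI p.δ₀ U ∧ L2TwoLegs37 (𝔬 x) 1 (H x) (S2 x) p.B2 p.δ₀ U ∧ FactorsL2_37 (𝔬 x) 1 (H x) p.θ2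
      p.δ₀ U)
    (hl0 : ∀ x U, L2ReadsNbr (R := 1) (H := H x) ((opsYNuOfRecordV4E N θ.toStage3Params Mstar 𝔯 (sectEYOfRecordV5 N θ.toStage3Params Mstar 𝔢₀) 𝔴 𝔈) x).Gp 0 U (RelB x.toKIdx) 2 (Real.sqrt ((θ.d₆ + 1) * Fintype.card κK)) (𝔬 x).blk (𝔬 x).blk (evSK x.toKIdx) ((𝔬 x).Gp U))
    (hl1 : ∀ x U, L2ReadsNbr (R := 1) (H := H x) ((opsYNuOfRecordV4E N θ.toStage3Params Mstar 𝔯 (sectEYOfRecordV5 N θ.toStage3Params Mstar 𝔢₀) 𝔴 𝔈) x).Gp 1 U (RelB x.toKIdx) 2 (Real.sqrt ((θ.d₆ + 1) * Fintype.card κK)) (𝔬 x).blkY (𝔬 x).blk (evSK x.toKIdx) ((𝔬 x).D U ∘ₗ (𝔬 x).Gp U))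
    (hl2 : ∀ x U, L2ReadsNbr (R := 1) (H := H x) ((opsYNuOfRecordV4E N θ.toStage3Params Mstar 𝔯 (sectEYOfRecordV5 N θ.toStage3Params Mstar 𝔢₀) 𝔴 𝔈) x).Gp 2 U (RelB x.toKIdx) 2 (Real.sqrt ((θ.d₆ + 1) * Fintype.card κK)) (𝔬 x).blk (𝔬 x).blkY (evSK x.toKIdx) ((𝔬 x).Gp U ∘ₗ (𝔬 x).Dstar U))
    (hl3 : ∀ x U, L2ReadsNbr (R := 1) (H := H x) ((opsYNuOfRecordV4E N θ.toStage3Params Mstar 𝔯 (sectEYOfRecordV5 N θ.toStage3Params Mstar 𝔢₀) 𝔴 𝔈) x).Gp 3 U (RelB x.toKIdx) 2 (Real.sqrt ((θ.d₆ + 1) * Fintype.card κK)) (𝔬 x).blkY (𝔬 x).blkY (evSK x.toKIdx) ((𝔬 x).D U ∘ₗ ((𝔬 x).Gp U ∘ₗ (𝔬 x).Dstar U)))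
    (hl4 : ∀ x U, L2ReadsNbr (R := 1) (H := H x) ((opsYNuOfRecordV4E N θ.toStage3Params Mstar 𝔯 (sectEYOfRecordV5 N θ.toStage3Params Mstar 𝔢₀) 𝔴 𝔈) x).Gp 4 U (RelB x.toKIdx) 2 (Real.sqrt ((θ.d₆ + 1) * Fintype.card κK)) ((𝔬 x).blk ∘ Prod.fst) (𝔬 x).blk (evSK x.toKIdx) (familyOp fun r : Q x × Q x => ((𝔡 x).Dd U r.1 ∘ₗ (𝔡 x).Dd U r.2) ∘ₗ (𝔬 x).Gp U))
    (hl5 : ∀ x U, L2ReadsNbr (R := 1) (H := H x) ((opsYNuOfRecordV4E N θ.toStage3Params Mstar 𝔯 (sectEYOfRecordV5 N θ.toStage3Params Mstar 𝔢₀) 𝔴 𝔈) x).Gp 5 U (RelB x.toKIdx) 2 (Real.sqrt ((θ.d₆ + 1) * Fintype.card κK)) ((𝔬 x).blk ∘ Prod.fst) (𝔬 x).blk (evSK x.toKIdx) (familyOp fun r : Q x × Q x => (𝔬 x).Gp U ∘ₗ ((𝔡 x).Dsd U r.1 ∘ₗ (𝔡 x).Dsd U r.2)))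
    (hH1 : ∀ x U, H1ReadsNbr ((opsYNuOfRecordV4E N θ.toStage3Params Mstar 𝔯 (sectEYOfRecordV5 N θ.toStage3Params Mstar 𝔢₀) 𝔴 𝔈) x).Gp U (𝔭 x) (RelB x.toKIdx) 2 (𝔬 x).blk (𝔬 x).blkY (evSK x.toKIdx) (evSK x.toKIdx) ((𝔬 x).D U ∘ₗ (𝔬 x).Gp U) ((𝔬 x).Gp U ∘ₗ (𝔬 x).Dstar U))
    (hIR : ∀ x U, InputReadsNbr ((opsYNuOfRecordV4E N θ.toStage3Params Mstar 𝔯 (sectEYOfRecordV5 N θ.toStage3Params Mstar 𝔢₀) 𝔴 𝔈) x).Gp U (𝔭 x) (bH x) 2 (𝔬 x).blkY (evSK x.toKIdx) ((𝔬 x).D U ∘ₗ ((𝔬 x).Gp U ∘ₗ (𝔬 x).Dstar U))) (hsym : ∀ x U, IsTransposePair ((𝔬 x).Gp U) ((𝔬 x).Gp U))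
    (htr : ∀ x U, IsTransposePair ((𝔬 x).D U ∘ₗ (𝔬 x).Gp U) ((𝔬 x).Gp U ∘ₗ (𝔬 x).Dstar U)) (hcntH : ∀ x (a : (geo9Y x).Site), (∑ c, if a ∈ SH x c then (1 : ℝ) else 0) ≤ p.NH)
    (hcnt3 : ∀ x (a : (geo9Y x).Site), (∑ c, if a ∈ S3 x c then (1 : ℝ) else 0) ≤ p3.N3) (hNQ : ∀ x, (Fintype.card (Q x) : ℝ) ≤ NQ) (hcntI : ∀ x (a : (geo9Y x).Site), (∑ c, if a ∈ SI x c then (1 : ℝ) else 0) ≤ p.NI) (hcnt2 : ∀ x (a : (geo9Y x).Site), (∑ c, if a ∈ S2 x c then (1 : ℝ) else 0) ≤ p.N2)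
    -- the G side (Theorem 3.10)
    (𝔬A : ∀ x : MemberY θ.d₆ θ.ℓ₆ θ.hd' θ.hL' θ.b₀ θ.b₁ Mstar, Ops310 (geo9Y x) (bg9Y (Matrix (Fin N) (Fin N) ℂ) (specialUnitaryUnits (Fin N)) x) (XBK κK x.toKIdx) (XBK κK x.toKIdx) (ιA x) (AA x))
    (rdA : ∀ x : MemberY θ.d₆ θ.ℓ₆ θ.hd' θ.hL' θ.b₀ θ.b₁ Mstar, WalkReading310 (geo9Y x) (bg9Y (Matrix (Fin N) (Fin N) ℂ) (specialUnitaryUnits (Fin N)) x) (XBK κK x.toKIdx) (ιA x) (AA x))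
    (𝔭A : ∀ x : MemberY θ.d₆ θ.ℓ₆ θ.hd' θ.hL' θ.b₀ θ.b₁ Mstar, HolderProbes (geo9Y x) (bg9Y (Matrix (Fin N) (Fin N) ℂ) (specialUnitaryUnits (Fin N)) x) (XBK κK x.toKIdx) (XBK κK x.toKIdx) (PXA x) (PYA x))
    (𝔡A : ∀ x : MemberY θ.d₆ θ.ℓ₆ θ.hd' θ.hL' θ.b₀ θ.b₁ Mstar, DirOps310 (𝔬A x) (QA x))
    (bHA : ∀ x : MemberY θ.d₆ θ.ℓ₆ θ.hd' θ.hL' θ.b₀ θ.b₁ Mstar, ℝ → BlockNorm (toB6 (geo9Y x) 1 (H x)) (XBK κK x.toKIdx → ℝ)) (κA : MemberY θ.d₆ θ.ℓ₆ θ.hd' θ.hL' θ.b₀ θ.b₁ Mstar → Sizes310) (SHA S3A SIA S2A : ∀ x : MemberY θ.d₆ θ.ℓ₆ θ.hd' θ.hL' θ.b₀ θ.b₁ Mstar, ιA x → Finset (geo9Y x).Site)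
    (hstA : ∀ x, StaticOK310 (𝔬A x) q.ρ q.Nc q.N' q.NF q.Cℓ (κA x)) (hκA : ∀ x, (κA x).Bounded q.Kc) (hrdA : ∀ x, (rdA x).OK (𝔬A x).blk) (hlocA : ∀ x, Locality310 (𝔬A x) (rdA x))
    (h36A : ∀ x, q.M₁ ≤ (geo9Y x).M → ∀ α₀ : ℝ, 0 < α₀ → c35Y * (geo9Y x).M * α₀ ≤ q.a₁ → ∀ U : (bg9Y (Matrix (Fin N) (Fin N) ℂ) (specialUnitaryUnits (Fin N)) x).Cfg, (bg9Y (Matrix (Fin N) (Fin N) ℂ) (specialUnitaryUnits (Fin N)) x).Reg335 c35Y α₀ U → Local342G (𝔬A x) 1 (H x) q.B₀ q.δ₀ U ∧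
      B9Thm310Whole.Factors389 (𝔬A x) 1 (H x) q.θ₀ q.δ₀ U ∧ Identities310 (𝔬A x) 1 (H x) U)
    (h36HA : ∀ x, q.M₁ ≤ (geo9Y x).M → ∀ α₀ : ℝ, 0 < α₀ → c35Y * (geo9Y x).M * α₀ ≤ q.a₁ → ∀ U : (bg9Y (Matrix (Fin N) (Fin N) ℂ) (specialUnitaryUnits (Fin N)) x).Cfg, (bg9Y (Matrix (Fin N) (Fin N) ℂ) (specialUnitaryUnits (Fin N)) x).Reg335 c35Y α₀ U → HolderLegs310 (𝔬A x) (𝔭A x) 1 (H x) (SHA x)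
      q.Bl q.δ₀ U ∧ FactorsHolder310 (𝔬A x) (𝔭A x) 1 (H x) q.Bt q.δ₀ U ∧ (L2SecondLegs310 (𝔬A x) (𝔡A x) 1 (H x) (S3A x) q3.B3 q.δ₀ U ∧ FactorsL2Second310 (𝔬A x) (𝔡A x) 1 (H x) q3.θ3 q.δ₀ U ∧ DirTranspose310 (𝔬A x) (𝔡A x) U) ∧ InputLegs310 (𝔬A x) (𝔭A x) 1 (H x) (bHA x) (SIA x) q.BI q.BI2 q.δ₀ U ∧ FactorsInput310 (𝔬A x) 1 (H x) (bHA x) q.θI q.δ₀ U ∧ L2TwoLegs310 (𝔬A x) 1 (H x) (S2A x) q.B2 q.δ₀ U ∧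
      FactorsL2_310 (𝔬A x) 1 (H x) q.θ2 q.δ₀ U)
    (hlA3 : ∀ x U, L2ReadsNbr (R := 1) (H := H x) ((opsYNuOfRecordV4E N θ.toStage3Params Mstar 𝔯 (sectEYOfRecordV5 N θ.toStage3Params Mstar 𝔢₀) 𝔴 𝔈) x).GA 3 U (RelB x.toKIdx) 2 (Real.sqrt ((θ.d₆ + 1) * Fintype.card κK)) (𝔬A x).blkY (𝔬A x).blkY (evBK x.toKIdx) ((𝔬A x).D U ∘ₗ ((𝔬A x).G U ∘ₗ (𝔬A x).Dstar U)))
    (hlA4 : ∀ x U, L2ReadsNbr (R := 1) (H := H x) ((opsYNuOfRecordV4E N θ.toStage3Params Mstar 𝔯 (sectEYOfRecordV5 N θ.toStage3Params Mstar 𝔢₀) 𝔴 𝔈) x).GA 4 U (RelB x.toKIdx) 2 (Real.sqrt ((θ.d₆ + 1) * Fintype.card κK)) ((𝔬A x).blk ∘ Prod.fst) (𝔬A x).blk (evBK x.toKIdx) (familyOp fun r : QA x × QA x => ((𝔡A x).Dd U r.1 ∘ₗ (𝔡A x).Dd U r.2) ∘ₗ (𝔬A x).G U))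
    (hlA5 : ∀ x U, L2ReadsNbr (R := 1) (H := H x) ((opsYNuOfRecordV4E N θ.toStage3Params Mstar 𝔯 (sectEYOfRecordV5 N θ.toStage3Params Mstar 𝔢₀) 𝔴 𝔈) x).GA 5 U (RelB x.toKIdx) 2 (Real.sqrt ((θ.d₆ + 1) * Fintype.card κK)) ((𝔬A x).blk ∘ Prod.fst) (𝔬A x).blk (evBK x.toKIdx) (familyOp fun r : QA x × QA x => (𝔬A x).G U ∘ₗ ((𝔡A x).Dsd U r.1 ∘ₗ (𝔡A x).Dsd U r.2)))
    (hH1A : ∀ x U, H1ReadsNbr ((opsYNuOfRecordV4E N θ.toStage3Params Mstar 𝔯 (sectEYOfRecordV5 N θ.toStage3Params Mstar 𝔢₀) 𝔴 𝔈) x).GA U (𝔭A x) (RelB x.toKIdx) 2 (𝔬A x).blk (𝔬A x).blkY (evBK x.toKIdx) (evBK x.toKIdx) ((𝔬A x).D U ∘ₗ (𝔬A x).G U) ((𝔬A x).G U ∘ₗ (𝔬A x).Dstar U))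
    (hIRA : ∀ x U, InputReadsNbr ((opsYNuOfRecordV4E N θ.toStage3Params Mstar 𝔯 (sectEYOfRecordV5 N θ.toStage3Params Mstar 𝔢₀) 𝔴 𝔈) x).GA U (𝔭A x) (bHA x) 2 (𝔬A x).blkY (evBK x.toKIdx) ((𝔬A x).D U ∘ₗ ((𝔬A x).G U ∘ₗ (𝔬A x).Dstar U))) (hsymA : ∀ x U, IsTransposePair ((𝔬A x).G U) ((𝔬A x).G U))
    (htrA : ∀ x U, IsTransposePair ((𝔬A x).D U ∘ₗ (𝔬A x).G U) ((𝔬A x).G U ∘ₗ (𝔬A x).Dstar U)) (hcntHA : ∀ x (a : (geo9Y x).Site), (∑ c, if a ∈ SHA x c then (1 : ℝ) else 0) ≤ q.NH)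
    (hcnt3A : ∀ x (a : (geo9Y x).Site), (∑ c, if a ∈ S3A x c then (1 : ℝ) else 0) ≤ q3.N3) (hNQA : ∀ x, (Fintype.card (QA x) : ℝ) ≤ NQ) (hcntIA : ∀ x (a : (geo9Y x).Site), (∑ c, if a ∈ SIA x c then (1 : ℝ) else 0) ≤ q.NI) (hcnt2A : ∀ x (a : (geo9Y x).Site), (∑ c, if a ∈ S2A x c then (1 : ℝ) else 0) ≤ q.N2)
    (hE37 : ∀ x : MemberY θ.d₆ θ.ℓ₆ θ.hd' θ.hL' θ.b₀ θ.b₁ Mstar, ((opsYNuOfRecordV4E N θ.toStage3Params Mstar 𝔯 (sectEYOfRecordV5 N θ.toStage3Params Mstar 𝔢₀) 𝔴 𝔈) x).E37 = E37YPair (bg := bg9Y (Matrix (Fin N) (Fin N) ℂ) (specialUnitaryUnits (Fin N))) (2 * (θ.d₆ + 1)) mN (Real.sqrt ((θ.d₆ + 1) * Fintype.card κK)) NQ p q p3 q3 (𝔬 x) (rd x) (H x) ((opsYNuOfRecordV4E N θ.toStage3Params Mstar 𝔯 (sectEYOfRecordV5 N θ.toStage3Params Mstar 𝔢₀) 𝔴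 𝔈) x).Gp)
    (hE310 : ∀ x : MemberY θ.d₆ θ.ℓ₆ θ.hd' θ.hL' θ.b₀ θ.b₁ Mstar, ((opsYNuOfRecordV4E N θ.toStage3Params Mstar 𝔯 (sectEYOfRecordV5 N θ.toStage3Params Mstar 𝔢₀) 𝔴 𝔈) x).E310 = E310YPair (bg := bg9Y (Matrix (Fin N) (Fin N) ℂ) (specialUnitaryUnits (Fin N))) (2 * (θ.d₆ + 1)) mN (Real.sqrt ((θ.d₆ + 1) * Fintype.card κK)) NQ p q p3 q3 (𝔬A x) (rdA x) (H x) ((opsYNuOfRecordV4E N θ.toStage3Params Mstar 𝔯 (sectEYOfRecordV5 N θ.toStage3Params Mstar 𝔢₀) 𝔴 𝔈)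
      x).GA)
    -- PINS of the G-side walk letters to the coordinate model of the GENUINE `G(U)` (block maps, models of G, ∇_U, ∇*_U, Δ_U) — the four `CoRealizesRel` and four `GlobReads` co-readings are theorems
    (hblkA : ∀ x : MemberY θ.d₆ θ.ℓ₆ θ.hd' θ.hL' θ.b₀ θ.b₁ Mstar, (𝔬A x).blk = blkBK x.toKIdx (bI x)) (hblkYA : ∀ x : MemberY θ.d₆ θ.ℓ₆ θ.hd' θ.hL' θ.b₀ θ.b₁ Mstar, (𝔬A x).blkY = blkBK x.toKIdx (bI x))
    (hGcoA : ∀ (x : MemberY θ.d₆ θ.ℓ₆ θ.hd' θ.hL' θ.b₀ θ.b₁ Mstar) (U : (bg9Y (Matrix (Fin N) (Fin N) ℂ) (specialUnitaryUnits (Fin N)) x).Cfg), (𝔬A x).G U = GcoK x.toKIdx bK (bg9Y (Matrix (Fin N) (Fin N) ℂ) (specialUnitaryUnits (Fin N)) x) (fun U => U) (lettersYOfRecordV4 N θ.toStage3Params Mstar 𝔯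
      x).GA U)
    (hDcoA : ∀ (x : MemberY θ.d₆ θ.ℓ₆ θ.hd' θ.hL' θ.b₀ θ.b₁ Mstar) (U : (bg9Y (Matrix (Fin N) (Fin N) ℂ) (specialUnitaryUnits (Fin N)) x).Cfg), (𝔬A x).D U = DcoK x.toKIdx bK (bg9Y (Matrix (Fin N) (Fin N) ℂ) (specialUnitaryUnits (Fin N)) x) (fun U => U) U)
    (hDscoA : ∀ (x : MemberY θ.d₆ θ.ℓ₆ θ.hd' θ.hL' θ.b₀ θ.b₁ Mstar) (U : (bg9Y (Matrix (Fin N) (Fin N) ℂ) (specialUnitaryUnits (Fin N)) x).Cfg), (𝔬A x).Dstar U = DscoK x.toKIdx bK (bg9Y (Matrix (Fin N) (Fin N) ℂ) (specialUnitaryUnits (Fin N)) x) (fun U => U) U)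
    (hLcoA : ∀ (x : MemberY θ.d₆ θ.ℓ₆ θ.hd' θ.hL' θ.b₀ θ.b₁ Mstar) (U : (bg9Y (Matrix (Fin N) (Fin N) ℂ) (specialUnitaryUnits (Fin N)) x).Cfg), (𝔬A x).Lap U = LcoK x.toKIdx bK (bg9Y (Matrix (Fin N) (Fin N) ℂ) (specialUnitaryUnits (Fin N)) x) (fun U => U) U)
    -- THE SITE PINS (row 18's G′ side): block maps through `sIK (bI x)`, models = `B9CoReadingCoordsS` coordinate models of def-Y's GENUINE site-sector letter `(𝔏 x).Gp`
    (hblkS : ∀ x : MemberY θ.d₆ θ.ℓ₆ θ.hd' θ.hL' θ.b₀ θ.b₁ Mstar, (𝔬 x).blk = blkSK x.toKIdx (sIK x.toKIdx (bI x))) (hblkYS : ∀ x : MemberY θ.d₆ θ.ℓ₆ θ.hd' θ.hL' θ.b₀ θ.b₁ Mstar, (𝔬 x).blkY = blkSK x.toKIdx (sIK x.toKIdx (bI x)))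
    (hGpS : ∀ (x : MemberY θ.d₆ θ.ℓ₆ θ.hd' θ.hL' θ.b₀ θ.b₁ Mstar) U, (𝔬 x).Gp U = GcoS x.toKIdx bK (bg9Y (Matrix (Fin N) (Fin N) ℂ) (specialUnitaryUnits (Fin N)) x) (fun U => U) (lettersYOfRecordV4 N θ.toStage3Params Mstar 𝔯 x).Gp U) (hDS : ∀ (x : MemberY θ.d₆ θ.ℓ₆ θ.hd' θ.hL' θ.b₀ θ.b₁ Mstar) U, (𝔬 x).D U = DcoS x.toKIdx bK (bg9Y (Matrix (Fin N) (Fin N) ℂ) (specialUnitaryUnits (Fin N)) x) (fun U => U) U)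
    (hDsS : ∀ (x : MemberY θ.d₆ θ.ℓ₆ θ.hd' θ.hL' θ.b₀ θ.b₁ Mstar) U, (𝔬 x).Dstar U = DscoS x.toKIdx bK (bg9Y (Matrix (Fin N) (Fin N) ℂ) (specialUnitaryUnits (Fin N)) x) (fun U => U) U) (hLapS : ∀ (x : MemberY θ.d₆ θ.ℓ₆ θ.hd' θ.hL' θ.b₀ θ.b₁ Mstar) U, (𝔬 x).Lap U = LcoS x.toKIdx bK (bg9Y (Matrix (Fin N) (Fin N) ℂ) (specialUnitaryUnits (Fin N)) x) (fun U => U) U)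
    -- rows 20–21 on n06-l g3's REPAIRED leaves `thm312Printed_of_stepRelH` ∕ `thm313Printed_of_stepRel`: walk letters `𝔬12`, numerics, (3.42) co-readings in the `Rel` species
    -- (`RelB` = same carrier block, multiplicity 2(d+1) discharged), (3.133) co-readings PROVED on the H-coordinate model (`B9CoReadingCoordsH`), (3.47) `hcoG12`∕`hcoG13` fibre-free, model schemas, residuals, pins — reading the GENUINE Sect.-D letters
    {W12 : MemberY θ.d₆ θ.ℓ₆ θ.hd' θ.hL' θ.b₀ θ.b₁ Mstar → Type} [∀ x, Fintype (W12 x)]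
    (𝔬12 : ∀ x : MemberY θ.d₆ θ.ℓ₆ θ.hd' θ.hL' θ.b₀ θ.b₁ Mstar, B9Thm312Whole.Ops (geo9Y x) (bg9Y (Matrix (Fin N) (Fin N) ℂ) (specialUnitaryUnits (Fin N)) x) (XBK κK x.toKIdx) (XBK κK x.toKIdx) (XHK κK x.toKIdx) (W12 x)) (H12 : MemberY θ.d₆ θ.ℓ₆ θ.hd' θ.hL' θ.b₀ θ.b₁ Mstar → Prop)
    (bH13 : ∀ x : MemberY θ.d₆ θ.ℓ₆ θ.hd' θ.hL' θ.b₀ θ.b₁ Mstar, BlockNorm (toB6 (geo9Y x) 1 (H12 x)) (W12 x → ℝ)) (θ12 θD12 r12 B12₀ δ12₀ δK12 σ12 ρ12 a12 M12 B12₁ δ12₁ B12₃ δ12₃ ρ13 α12 κ13 : ℝ) (Bβ12 Bε12 : ℝ → ℝ) (Bεβ12 : ℝ → ℝ → ℝ) (hθ12 : 0 ≤ θ12) (hθD12 : 0 ≤ θD12) (hr12 : 0 ≤ r12)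
    (hB12₀ : 0 ≤ B12₀) (hB12₃ : 0 ≤ B12₃) (hσ12 : 0 < σ12) (hρ12 : 0 < ρ12) (hρS12 : ρ12 ≤ δ12₀) (hρδ12 : ρ12 + σ12 ≤ δK12) (hρ₃12 : ρ12 + σ12 ≤ δ12₃) (ha12 : 0 < a12) (hM12 : 0 < M12) (hδ12₁ : 0 < δ12₁) (hα12 : 0 < α12) (hα12' : α12 ≤ 1 / 2) (hBβ12 : ∀ β, 0 ≤ Bβ12 β) (hBε12 : ∀ ε, 0 ≤ Bε12 ε)
    (hBεβ12 : ∀ ε β, 0 ≤ Bεβ12 ε β) (hκ13 : ∀ x, (bH13 x).κ ≤ κ13) (hρ13 : 0 < ρ13) (hρ13ρ : ρ13 + 3 * σ12 ≤ ρ12)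
    (hmodel12 : ∀ x : MemberY θ.d₆ θ.ℓ₆ θ.hd' θ.hL' θ.b₀ θ.b₁ Mstar, M12 ≤ (geo9Y x).M → ∀ α₀ : ℝ, 0 < α₀ → (geo9Y x).M * α₀ ≤ a12 → ∀ U : (bg9Y (Matrix (Fin N) (Fin N) ℂ) (specialUnitaryUnits (Fin N)) x).Cfg, (bg9Y (Matrix (Fin N) (Fin N) ℂ) (specialUnitaryUnits (Fin N)) x).Reg335 c35Y α₀ U →
      (bg9Y (Matrix (Fin N) (Fin N) ℂ) (specialUnitaryUnits (Fin N)) x).Reg336 c35Y α₀ U → Thm33G0 (𝔬12 x) 1 (H12 x) B12₀ δ12₀ U ∧ B9Thm312Whole.Step (𝔬12 x) 1 (H12 x) (fun y => (geo9Y_len_pos x y).le) 1 (θ12 * ((geo9Y x).M * α₀)) δK12 U ∧ B9Thm312Whole.Step (𝔬12 x) 1 (H12 x) (fun y =>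
      (geo9Y_len_pos x y).le) 2 (θ12 * ((geo9Y x).M * α₀)) δK12 U ∧ FormSmall (𝔬12 x) (r12 * ((geo9Y x).M * α₀)) U ∧ B9Thm312Whole.Identities (𝔬12 x) U)
    (hleft12 : ∀ x : MemberY θ.d₆ θ.ℓ₆ θ.hd' θ.hL' θ.b₀ θ.b₁ Mstar, M12 ≤ (geo9Y x).M → ∀ α₀ : ℝ, 0 < α₀ → (geo9Y x).M * α₀ ≤ a12 → ∀ U : (bg9Y (Matrix (Fin N) (Fin N) ℂ) (specialUnitaryUnits (Fin N)) x).Cfg, (bg9Y (Matrix (Fin N) (Fin N) ℂ) (specialUnitaryUnits (Fin N)) x).Reg335 c35Y α₀ U → (bg9Y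
      (Matrix (Fin N) (Fin N) ℂ) (specialUnitaryUnits (Fin N)) x).Reg336 c35Y α₀ U → LeftStep (𝔬12 x) 1 (H12 x) (fun y => (geo9Y_len_pos x y).le) B12₀ δ12₀ (θD12 * ((geo9Y x).M * α₀)) δK12 U)
    (hlettersH12 : ∀ x : MemberY θ.d₆ θ.ℓ₆ θ.hd' θ.hL' θ.b₀ θ.b₁ Mstar, M12 ≤ (geo9Y x).M → ∀ α₀ : ℝ, 0 < α₀ → (geo9Y x).M * α₀ ≤ a12 → ∀ U : (bg9Y (Matrix (Fin N) (Fin N) ℂ) (specialUnitaryUnits (Fin N)) x).Cfg, (bg9Y (Matrix (Fin N) (Fin N) ℂ) (specialUnitaryUnits (Fin N)) x).Reg335 c35Y α₀ U →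
      (bg9Y (Matrix (Fin N) (Fin N) ℂ) (specialUnitaryUnits (Fin N)) x).Reg336 c35Y α₀ U → LettersH (𝔬12 x) 1 (H12 x) ⟨geo9Y_dist_triangle x, geo9Y_dist_comm x, geo9K_dist_nonneg x.toKIdx, geo9Y_len_pos x⟩ B12₃ δ12₃ U)
    (hres12 : ∀ x : MemberY θ.d₆ θ.ℓ₆ θ.hd' θ.hL' θ.b₀ θ.b₁ Mstar, M12 ≤ (geo9Y x).M → ∀ α₀ : ℝ, 0 < α₀ → (geo9Y x).M * α₀ ≤ a12 → ∀ U : (bg9Y (Matrix (Fin N) (Fin N) ℂ) (specialUnitaryUnits (Fin N)) x).Cfg, (bg9Y (Matrix (Fin N) (Fin N) ℂ) (specialUnitaryUnits (Fin N)) x).Reg335 c35Y α₀ U → (bg9Y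
      (Matrix (Fin N) (Fin N) ℂ) (specialUnitaryUnits (Fin N)) x).Reg336 c35Y α₀ U → (∀ K ∈ [((opsYNuOfRecordV4E N θ.toStage3Params Mstar 𝔯 (sectEYOfRecordV5 N θ.toStage3Params Mstar 𝔢₀) 𝔴 𝔈) x).GD, ((opsYNuOfRecordV4E N θ.toStage3Params Mstar 𝔯 (sectEYOfRecordV5 N θ.toStage3Params Mstar 𝔢₀) 𝔴 𝔈) x).G₁], L2Block K B12₁ δ12₁ U ∧ B9.Ineq343_345 K Bβ12 Bε12 Bεβ12 δ12₁ U) ∧ (∀ Hk' ∈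
      [((opsYNuOfRecordV4E N θ.toStage3Params Mstar 𝔯 (sectEYOfRecordV5 N θ.toStage3Params Mstar 𝔢₀) 𝔴 𝔈) x).H, ((opsYNuOfRecordV4E N θ.toStage3Params Mstar 𝔯 (sectEYOfRecordV5 N θ.toStage3Params Mstar 𝔢₀) 𝔴 𝔈) x).H₁], ∀ (β : ℝ) (ζ : (geo9Y x).Cut) (y y' : (geo9Y x).Site), 0 ≤ β → β < 1 → (geo9Y x).cutInT ζ y → Hk'.h U β ζ y' ≤ Bβ12 β * (geo9Y x).cutH β ζ * ((geo9Y x).len y) ^ (-(1 + β)) *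
      ((geo9Y x).len y') ^ (-((θ.d₆ + 1 : ℕ) : ℝ)) * Real.exp (-(δ12₁ / 2 * (geo9Y x).dist y y'))))
    (hpinE : ∀ x : MemberY θ.d₆ θ.ℓ₆ θ.hd' θ.hL' θ.b₀ θ.b₁ Mstar, ((opsYNuOfRecordV4E N θ.toStage3Params Mstar 𝔯 (sectEYOfRecordV5 N θ.toStage3Params Mstar 𝔢₀) 𝔴 𝔈) x).HasRWExp = HasRWExpOfOps (𝔬12 x))
    (hpinH : ∀ x : MemberY θ.d₆ θ.ℓ₆ θ.hd' θ.hL' θ.b₀ θ.b₁ Mstar, ((opsYNuOfRecordV4E N θ.toStage3Params Mstar 𝔯 (sectEYOfRecordV5 N θ.toStage3Params Mstar 𝔢₀) 𝔴 𝔈) x).HasRWExpH = HasRWExpHOfOps (𝔬12 x))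
    (hpinK : ∀ x : MemberY θ.d₆ θ.ℓ₆ θ.hd' θ.hL' θ.b₀ θ.b₁ Mstar, ((opsYNuOfRecordV4E N θ.toStage3Params Mstar 𝔯 (sectEYOfRecordV5 N θ.toStage3Params Mstar 𝔢₀) 𝔴 𝔈) x).PosDefK = PosDefKOfOps (𝔬12 x))
    -- PINS of Theorems 3.12–3.13's walk letters to the coordinate models of the GENUINE `GD G₁ GG` — the nine `CoRealizesRel` and nine `CoReadsGlob` co-readings are theorems
    (hblk12 : ∀ x : MemberY θ.d₆ θ.ℓ₆ θ.hd' θ.hL' θ.b₀ θ.b₁ Mstar, (𝔬12 x).blk = blkBK x.toKIdx (bI x)) (hblkY12 : ∀ x : MemberY θ.d₆ θ.ℓ₆ θ.hd' θ.hL' θ.b₀ θ.b₁ Mstar, (𝔬12 x).blkY = blkBK x.toKIdx (bI x))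
    (hGco12 : ∀ (x : MemberY θ.d₆ θ.ℓ₆ θ.hd' θ.hL' θ.b₀ θ.b₁ Mstar) (U : (bg9Y (Matrix (Fin N) (Fin N) ℂ) (specialUnitaryUnits (Fin N)) x).Cfg), (𝔬12 x).G U = GcoK x.toKIdx bK (bg9Y (Matrix (Fin N) (Fin N) ℂ) (specialUnitaryUnits (Fin N)) x) (fun U => U) (lettersYOfRecordV4 N θ.toStage3Params Mstar 𝔯 x).GD U)
    (hG1co12 : ∀ (x : MemberY θ.d₆ θ.ℓ₆ θ.hd' θ.hL' θ.b₀ θ.b₁ Mstar) (U : (bg9Y (Matrix (Fin N) (Fin N) ℂ) (specialUnitaryUnits (Fin N)) x).Cfg), (𝔬12 x).G1 U = GcoK x.toKIdx bK (bg9Y (Matrix (Fin N) (Fin N) ℂ) (specialUnitaryUnits (Fin N)) x) (fun U => U) (lettersYOfRecordV4 N θ.toStage3Params Mstar 𝔯 x).G₁ U)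
    (hGGco12 : ∀ (x : MemberY θ.d₆ θ.ℓ₆ θ.hd' θ.hL' θ.b₀ θ.b₁ Mstar) (U : (bg9Y (Matrix (Fin N) (Fin N) ℂ) (specialUnitaryUnits (Fin N)) x).Cfg), (𝔬12 x).GG U = GcoK x.toKIdx bK (bg9Y (Matrix (Fin N) (Fin N) ℂ) (specialUnitaryUnits (Fin N)) x) (fun U => U) (lettersYOfRecordV4 N θ.toStage3Params Mstar 𝔯 x).GG U)
    (hDco12 : ∀ (x : MemberY θ.d₆ θ.ℓ₆ θ.hd' θ.hL' θ.b₀ θ.b₁ Mstar) (U : (bg9Y (Matrix (Fin N) (Fin N) ℂ) (specialUnitaryUnits (Fin N)) x).Cfg), (𝔬12 x).D U = DcoK x.toKIdx bK (bg9Y (Matrix (Fin N) (Fin N) ℂ) (specialUnitaryUnits (Fin N)) x) (fun U => U) U)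
    (hDsco12 : ∀ (x : MemberY θ.d₆ θ.ℓ₆ θ.hd' θ.hL' θ.b₀ θ.b₁ Mstar) (U : (bg9Y (Matrix (Fin N) (Fin N) ℂ) (specialUnitaryUnits (Fin N)) x).Cfg), (𝔬12 x).Dstar U = DscoK x.toKIdx bK (bg9Y (Matrix (Fin N) (Fin N) ℂ) (specialUnitaryUnits (Fin N)) x) (fun U => U) U)
    -- PINS of the H-letters' walk data to the coordinate model of the GENUINE `H ∕ H₁` (n06-d `B9CoReadingCoordsH`): input carrier `XHK κK` (coarse point × slots), block map
    -- `blkHK` = the coarse point, model `HcoK` — the four (3.133) co-readings `hcoHR12` are theorems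
    (hblkZ12 : ∀ x : MemberY θ.d₆ θ.ℓ₆ θ.hd' θ.hL' θ.b₀ θ.b₁ Mstar, (𝔬12 x).blkZ = blkHK x.toKIdx)
    (hHm12 : ∀ (x : MemberY θ.d₆ θ.ℓ₆ θ.hd' θ.hL' θ.b₀ θ.b₁ Mstar) (U : (bg9Y (Matrix (Fin N) (Fin N) ℂ) (specialUnitaryUnits (Fin N)) x).Cfg), (𝔬12 x).Hm U = HcoK x.toKIdx bK (bg9Y (Matrix (Fin N) (Fin N) ℂ) (specialUnitaryUnits (Fin N)) x) (fun U => U) (lettersYOfRecordV4 N θ.toStage3Params Mstar 𝔯 x).H U)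
    (hH1m12 : ∀ (x : MemberY θ.d₆ θ.ℓ₆ θ.hd' θ.hL' θ.b₀ θ.b₁ Mstar) (U : (bg9Y (Matrix (Fin N) (Fin N) ℂ) (specialUnitaryUnits (Fin N)) x).Cfg), (𝔬12 x).H1m U = HcoK x.toKIdx bK (bg9Y (Matrix (Fin N) (Fin N) ℂ) (specialUnitaryUnits (Fin N)) x) (fun U => U) (lettersYOfRecordV4 N θ.toStage3Params Mstar 𝔯 x).H₁ U)
    (hletters13 : ∀ x : MemberY θ.d₆ θ.ℓ₆ θ.hd' θ.hL' θ.b₀ θ.b₁ Mstar, M12 ≤ (geo9Y x).M → ∀ α₀ : ℝ, 0 < α₀ → (geo9Y x).M * α₀ ≤ a12 → ∀ U : (bg9Y (Matrix (Fin N) (Fin N) ℂ) (specialUnitaryUnits (Fin N)) x).Cfg, (bg9Y (Matrix (Fin N) (Fin N) ℂ) (specialUnitaryUnits (Fin N)) x).Reg335 c35Y α₀ U →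
      (bg9Y (Matrix (Fin N) (Fin N) ℂ) (specialUnitaryUnits (Fin N)) x).Reg336 c35Y α₀ U → Letters313 (𝔬12 x) 1 (H12 x) ⟨geo9Y_dist_triangle x, geo9Y_dist_comm x, geo9K_dist_nonneg x.toKIdx, geo9Y_len_pos x⟩ B12₃ δ12₃ U)
    (hlettersD13 : ∀ x : MemberY θ.d₆ θ.ℓ₆ θ.hd' θ.hL' θ.b₀ θ.b₁ Mstar, M12 ≤ (geo9Y x).M → ∀ α₀ : ℝ, 0 < α₀ → (geo9Y x).M * α₀ ≤ a12 → ∀ U : (bg9Y (Matrix (Fin N) (Fin N) ℂ) (specialUnitaryUnits (Fin N)) x).Cfg, (bg9Y (Matrix (Fin N) (Fin N) ℂ) (specialUnitaryUnits (Fin N)) x).Reg335 c35Y α₀ U →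
      (bg9Y (Matrix (Fin N) (Fin N) ℂ) (specialUnitaryUnits (Fin N)) x).Reg336 c35Y α₀ U → Letters313D (𝔬12 x) 1 (H12 x) ⟨geo9Y_dist_triangle x, geo9Y_dist_comm x, geo9K_dist_nonneg x.toKIdx, geo9Y_len_pos x⟩ B12₃ δ12₃ (bH13 x) U)
    (hres13 : ∀ x : MemberY θ.d₆ θ.ℓ₆ θ.hd' θ.hL' θ.b₀ θ.b₁ Mstar, M12 ≤ (geo9Y x).M → ∀ α₀ : ℝ, 0 < α₀ → (geo9Y x).M * α₀ ≤ a12 → ∀ U : (bg9Y (Matrix (Fin N) (Fin N) ℂ) (specialUnitaryUnits (Fin N)) x).Cfg, (bg9Y (Matrix (Fin N) (Fin N) ℂ) (specialUnitaryUnits (Fin N)) x).Reg335 c35Y α₀ U → (bg9Y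
      (Matrix (Fin N) (Fin N) ℂ) (specialUnitaryUnits (Fin N)) x).Reg336 c35Y α₀ U → L2Block ((opsYNuOfRecordV4E N θ.toStage3Params Mstar 𝔯 (sectEYOfRecordV5 N θ.toStage3Params Mstar 𝔢₀) 𝔴 𝔈) x).GG B12₁ δ12₁ U ∧ B9.Ineq343_345 ((opsYNuOfRecordV4E N θ.toStage3Params Mstar 𝔯 (sectEYOfRecordV5 N θ.toStage3Params Mstar 𝔢₀) 𝔴 𝔈) x).GG Bβ12 Bε12 Bεβ12 δ12₁ U)
    -- rows 22–23 on n06-m g3's face `thm314_pair_opsYOfRecordDE` (Thm 3.14 global ∕ localised for the GENUINE `Kdiff = KdiffY`, the cancellation reading PROVED):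
    -- the two sequences' walk-term letters with their Thm-3.10 all-norms leaves read through `kernelFamilyB`, localisation data + laws, walk sets, the located approximation identity
    {E14₁ E14₂ : ∀ x : MemberY θ.d₆ θ.ℓ₆ θ.hd' θ.hL' θ.b₀ θ.b₁ Mstar, B9.RWExpansion (geo9Y x) (bg9Y (Matrix (Fin N) (Fin N) ℂ) (specialUnitaryUnits (Fin N)) x)} (T14₁ : ∀ x : MemberY θ.d₆ θ.ℓ₆ θ.hd' θ.hL' θ.b₀ θ.b₁ Mstar, (E14₁ x).Walk → BondOpY (Matrix (Fin N) (Fin N) ℂ) x.toKIdx)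
    (T14₂ : ∀ x : MemberY θ.d₆ θ.ℓ₆ θ.hd' θ.hL' θ.b₀ θ.b₁ Mstar, (E14₂ x).Walk → BondOpY (Matrix (Fin N) (Fin N) ℂ) x.toKIdx) (X14₁ : ∀ x : MemberY θ.d₆ θ.ℓ₆ θ.hd' θ.hL' θ.b₀ θ.b₁ Mstar, (E14₁ x).Walk → ℕ → (geo9Y x).Site → Prop)
    (M14₁ : ∀ x : MemberY θ.d₆ θ.ℓ₆ θ.hd' θ.hL' θ.b₀ θ.b₁ Mstar, (E14₁ x).Walk → ℕ → Prop) (X14₂ : ∀ x : MemberY θ.d₆ θ.ℓ₆ θ.hd' θ.hL' θ.b₀ θ.b₁ Mstar, (E14₂ x).Walk → ℕ → (geo9Y x).Site → Prop) (M14₂ : ∀ x : MemberY θ.d₆ θ.ℓ₆ θ.hd' θ.hL' θ.b₀ θ.b₁ Mstar, (E14₂ x).Walk → ℕ → Prop)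
    (diam14 : MemberY θ.d₆ θ.ℓ₆ θ.hd' θ.hL' θ.b₀ θ.b₁ Mstar → ℝ) (r14 : ℝ) (hr14 : ∀ x, diam14 x ≤ r14)
    (near14₁ : ∀ (x : MemberY θ.d₆ θ.ℓ₆ θ.hd' θ.hL' θ.b₀ θ.b₁ Mstar) ω m p, M14₁ x ω m → X14₁ x ω m p → ∃ q, q ∈ OmegaC x.D x.D' ∧ tdistK (ℓ := θ.ℓ₆) (Mh := x.Mh) (k := x.k) (P := x.P') (kLab x p) q ≤ diam14 x)
    (first14₁ : ∀ (x : MemberY θ.d₆ θ.ℓ₆ θ.hd' θ.hL' θ.b₀ θ.b₁ Mstar) ω y, (E14₁ x).first ω y → X14₁ x ω 0 y)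
    (chain14₁ : ∀ (x : MemberY θ.d₆ θ.ℓ₆ θ.hd' θ.hL' θ.b₀ θ.b₁ Mstar) ω y y', (E14₁ x).first ω y → (E14₁ x).last ω y' → ∃ l : List (geo9Y x).Site, l.length = (E14₁ x).wlen ω ∧ (∀ (m : ℕ) (hm : m < l.length), X14₁ x ω (m + 1) (l[m])) ∧ B9Thm314.chainSum (geo9Y x).dist y l y' ≤ (E14₁ x).wdist ω y y')
    (near14₂ : ∀ (x : MemberY θ.d₆ θ.ℓ₆ θ.hd' θ.hL' θ.b₀ θ.b₁ Mstar) ω m p, M14₂ x ω m → X14₂ x ω m p → ∃ q, q ∈ OmegaC x.D x.D' ∧ tdistK (ℓ := θ.ℓ₆) (Mh := x.Mh) (k := x.k) (P := x.P') (kLab x p) q ≤ diam14 x)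
    (first14₂ : ∀ (x : MemberY θ.d₆ θ.ℓ₆ θ.hd' θ.hL' θ.b₀ θ.b₁ Mstar) ω y, (E14₂ x).first ω y → X14₂ x ω 0 y)
    (chain14₂ : ∀ (x : MemberY θ.d₆ θ.ℓ₆ θ.hd' θ.hL' θ.b₀ θ.b₁ Mstar) ω y y', (E14₂ x).first ω y → (E14₂ x).last ω y' → ∃ l : List (geo9Y x).Site, l.length = (E14₂ x).wlen ω ∧ (∀ (m : ℕ) (hm : m < l.length), X14₂ x ω (m + 1) (l[m])) ∧ B9Thm314.chainSum (geo9Y x).dist y l y' ≤ (E14₂ x).wdist ω y y')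
    (h14₁ : Thm310AllNormsPrinted c35Y geo9Y (bg9Y (Matrix (Fin N) (Fin N) ℂ) (specialUnitaryUnits (Fin N))) E14₁ (fun x ω => kernelFamilyB x.toKIdx (bg9Y (Matrix (Fin N) (Fin N) ℂ) (specialUnitaryUnits (Fin N)) x) (fun U => U) (T14₁ x ω) (lettersYOfRecordV4 N θ.toStage3Params Mstar 𝔯 x).parB))
    (h14₂ : Thm310AllNormsPrinted c35Y geo9Y (bg9Y (Matrix (Fin N) (Fin N) ℂ) (specialUnitaryUnits (Fin N))) E14₂ (fun x ω => kernelFamilyB x.toKIdx (bg9Y (Matrix (Fin N) (Fin N) ℂ) (specialUnitaryUnits (Fin N)) x) (fun U => U) (T14₂ x ω) (lettersYOfRecordV4 N θ.toStage3Params Mstar 𝔯 x).parB))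
    (W14₁ : ∀ x : MemberY θ.d₆ θ.ℓ₆ θ.hd' θ.hL' θ.b₀ θ.b₁ Mstar, ℕ → (geo9Y x).Site → (geo9Y x).Site → Finset (E14₁ x).Walk) (W14₂ : ∀ x : MemberY θ.d₆ θ.ℓ₆ θ.hd' θ.hL' θ.b₀ θ.b₁ Mstar, ℕ → (geo9Y x).Site → (geo9Y x).Site → Finset (E14₂ x).Walk) (hW14₁ : ∀ x, WalkSetsSpec (E14₁ x) (W14₁ x))
    (hW14₂ : ∀ x, WalkSetsSpec (E14₂ x) (W14₂ x)) (hcnt14₁ : WalkWeightsSummable geo9Y (bg9Y (Matrix (Fin N) (Fin N) ℂ) (specialUnitaryUnits (Fin N))) E14₁ W14₁) (hcnt14₂ : WalkWeightsSummable geo9Y (bg9Y (Matrix (Fin N) (Fin N) ℂ) (specialUnitaryUnits (Fin N))) E14₂ W14₂)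
    (hexp14 : ∀ (x : MemberY θ.d₆ θ.ℓ₆ θ.hd' θ.hL' θ.b₀ θ.b₁ Mstar) (U : (bg9Y (Matrix (Fin N) (Fin N) ℂ) (specialUnitaryUnits (Fin N)) x).Cfg), (E14₁ x).Converges U ∧ (E14₂ x).Converges U → ExpansionReads x.toKIdx (B := bg9Y (Matrix (Fin N) (Fin N) ℂ) (specialUnitaryUnits (Fin N)) x) (fun U => U)
      (lettersYOfRecordV4 N θ.toStage3Params Mstar 𝔯 x).Kdiff (pairOp (locDataY x (E14₁ x) (X14₁ x) (M14₁ x) (diam14 x)).Touches (locData₂ (locDataY x (E14₁ x) (X14₁ x) (M14₁ x) (diam14 x)) (X14₂ x) (M14₂ x)).Touches (T14₁ x) (T14₂ x)) (pairWalkSets (W14₁ x) (W14₂ x) (locDataY x (E14₁ x) (X14₁ x) (M14₁ x) (diam14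
      x)).Touches (locData₂ (locDataY x (E14₁ x) (X14₁ x) (M14₁ x) (diam14 x)) (X14₂ x) (M14₂ x)).Touches) U)
    -- row 25 on n06-i g6's DERIVED face `stmt349Printed_site_of_blockSchemas` ((3.49) for the GENUINE `P = I − R(U)` «using again Lemma 2.1»): block-complete Thm 3.1∕3.2-type inputs
    (h31S : Thm31SiteSchemas (Matrix (Fin N) (Fin N) ℂ) (specialUnitaryUnits (Fin N)) c35Y (lettersYOfRecordV4 N θ.toStage3Params Mstar 𝔯)) (h32B : Thm32BlkSchema (Matrix (Fin N) (Fin N) ℂ) (specialUnitaryUnits (Fin N)) c35Y (lettersYOfRecordV4 N θ.toStage3Params Mstar 𝔯))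
    -- row 26 on n06-i g7's REPAIRED face `B9Eq3132NuReading.s3132Nu_opsYNuOfRecordV4E` (p508771): the instance's two (3.132) fields ARE the ν-weighted readings
    -- (`siteKernelOfOpNu … (nuY (d+1) …)`, ν(y) = (Lʲη)^{−(1+D∕2)}Λ_y) of the GENUINE `(QGQ*)⁻¹(U)` ∕ `(QG₁Q*)⁻¹(U)`; displayed: their CT-type coercivity and decay in the
    -- Λ-NORMALISED matrix norms (`normMatY b26 (lamInvY …)`, real trace coordinates `b26`) — print's (3.132) inputs «as for Δ_k of [4] (2.142)»; at U = 1 both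
    -- inequalities are THEOREMS (n06-i `B9Eq3132NuReadingAtOne`, [4] Prop. 2.7); the flat-reading row of the earlier certificates (located false, O1∕O2) is GONE
    {F26 : Type} [Fintype F26] [DecidableEq F26] (b26 : Module.Basis F26 ℝ (Matrix (Fin N) (Fin N) ℂ))
    (hco26 : CoerciveUnder c35Y (fun x : MemberY θ.d₆ θ.ℓ₆ θ.hd' θ.hL' θ.b₀ θ.b₁ Mstar => geoComap (geo9Y x) (Prod.fst : (geo9Y x).Site × F26 → (geo9Y x).Site)) (bg9Y (Matrix (Fin N) (Fin N) ℂ) (specialUnitaryUnits (Fin N))) (fun x U => normMatY b26 (lamInvY x.toKIdx) (QGQY x.toKIdx (parSymY x.toKIdx) (parBY x.toKIdx) (GpY x.toKIdx (parSymY x.toKIdx)) U)))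
    (hdec26 : DecayUnder c35Y (fun x : MemberY θ.d₆ θ.ℓ₆ θ.hd' θ.hL' θ.b₀ θ.b₁ Mstar => geoComap (geo9Y x) (Prod.fst : (geo9Y x).Site × F26 → (geo9Y x).Site)) (bg9Y (Matrix (Fin N) (Fin N) ℂ) (specialUnitaryUnits (Fin N))) (fun x U => normMatY b26 (lamInvY x.toKIdx) (QGQY x.toKIdx (parSymY x.toKIdx) (parBY x.toKIdx) (GpY x.toKIdx (parSymY x.toKIdx)) U)))
    (hco₁26 : CoerciveUnder c35Y (fun x : MemberY θ.d₆ θ.ℓ₆ θ.hd' θ.hL' θ.b₀ θ.b₁ Mstar => geoComap (geo9Y x) (Prod.fst : (geo9Y x).Site × F26 → (geo9Y x).Site)) (bg9Y (Matrix (Fin N) (Fin N) ℂ) (specialUnitaryUnits (Fin N))) (fun x U => normMatY b26 (lamInvY x.toKIdx) (QGQOfY x.toKIdx (parBY x.toKIdx) (G1Y x.toKIdx (parSymY x.toKIdx) (parBY x.toKIdx) (GpY x.toKIdx (parSymY x.toKIdx)) (𝔯 x).Δ2) U)))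
    (hdec₁26 : DecayUnder c35Y (fun x : MemberY θ.d₆ θ.ℓ₆ θ.hd' θ.hL' θ.b₀ θ.b₁ Mstar => geoComap (geo9Y x) (Prod.fst : (geo9Y x).Site × F26 → (geo9Y x).Site)) (bg9Y (Matrix (Fin N) (Fin N) ℂ) (specialUnitaryUnits (Fin N))) (fun x U => normMatY b26 (lamInvY x.toKIdx) (QGQOfY x.toKIdx (parBY x.toKIdx) (G1Y x.toKIdx (parSymY x.toKIdx) (parBY x.toKIdx) (GpY x.toKIdx (parSymY x.toKIdx)) (𝔯 x).Δ2) U)))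
    -- row 24 at def-Y g5's v5 SECT. E LETTERS OF RECORD `sectEYOfRecordV5 … 𝔢₀` (genuine μ ∕ D̄ ∕ μ* ∕ D̄* over the averaged fields; `Node00/OpsYRecordV5`) through the
    -- (3.185) SLOT (n06-m `t315_opsYSectE_of_3185_on`): displayed are the (3.185) identity, the expansion clause of `𝔴` and the decay of `QG̃₂Q*` between Λ-bonds (G-B9-10);
    -- the outer-locality schema `LocalOuterY` of BOTH outer factors is PROVED at the record (`localOuterY_sectEYOfRecordV5`, r = ℓ+2, m_E = m_F = 1 + 4(d+1)ℓ); (3.187) DERIVED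
    {a₀E δ₁E B₁E : ℝ} (ha₀E : 0 < a₀E) (hδ₁E : 0 < δ₁E) (hB₁E : 0 < B₁E)
    (hE : ∀ (x : MemberY θ.d₆ θ.ℓ₆ θ.hd' θ.hL' θ.b₀ θ.b₁ Mstar) (α₀ : ℝ), 0 < α₀ → (geo9Y x).M * α₀ ≤ a₀E → ∀ U : (bg9Y (Matrix (Fin N) (Fin N) ℂ) (specialUnitaryUnits (Fin N)) x).Cfg, (bg9Y (Matrix (Fin N) (Fin N) ℂ) (specialUnitaryUnits (Fin N)) x).Reg335 c35Y α₀ U → (bg9Y (Matrix (Fin N) (Fin N) ℂ) (specialUnitaryUnits (Fin N)) x).Reg336 c35Y α₀ U →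
      givenBy3185Y x (lettersYOfRecordV4 N θ.toStage3Params Mstar 𝔯 x) (sectEYOfRecordV5 N θ.toStage3Params Mstar 𝔢₀ x) U ∧ hasRWExpCY (𝔴 x) U δ₁E ∧
        DecayMidOnY x (lettersYOfRecordV4 N θ.toStage3Params Mstar 𝔯 x) (sectEYOfRecordV5 N θ.toStage3Params Mstar 𝔢₀ x) B₁E U δ₁E)
    (P : B12.RunParams) : Dag.B9_main (leavesP w P) := by
  have hL1 : (1 : ℝ) ≤ ((θ.ℓ₆ + 1 : ℕ) : ℝ) := by exact_mod_cast Nat.succ_le_succ (Nat.zero_le _)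
  have t311 := t311_of_pins_opsYOfLettersV4₁ θ.toStage3Params Mstar 𝔯 𝔈 a311 M311 ha311 hM311 hΔA hPD
  have hmE : (0 : ℝ) < 1 + 4 * (((θ.d₆ + 1) * θ.ℓ₆ : ℕ) : ℝ) := by positivity
  have t315 := t315_opsYSectE_of_3185_on N θ.toStage3Params Mstar (opsYS349NuOfLetters N θ.toStage3Params Mstar (lettersYOfRecordV4 N θ.toStage3Params Mstar 𝔯) 𝔈) (lettersYOfRecordV4 N θ.toStage3Params Mstar 𝔯) (sectEYOfRecordV5 N θ.toStage3Params Mstar 𝔢₀) 𝔴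
    (r := (θ.ℓ₆ : ℝ) + 2) ha₀E hδ₁E hB₁E hmE hmE fun x α₀ hα hMa U hU hU' => by
    obtain ⟨h85, hRW, hS⟩ := hE x α₀ hα hMa U hU hU'; exact ⟨h85, hRW, localOuterY_sectEYOfRecordV5 N θ.toStage3Params Mstar 𝔢₀ x specialUnitaryUnits_le_unitaryUnits hU.1.1, hS⟩
  obtain ⟨t314, t314loc⟩ : B9.Thm314Printed c35Y geo9Y (bg9Y (Matrix (Fin N) (Fin N) ℂ) (specialUnitaryUnits (Fin N))) (fun x => ((opsYNuOfRecordV4E N θ.toStage3Params Mstar 𝔯 (sectEYOfRecordV5 N θ.toStage3Params Mstar 𝔢₀) 𝔴 𝔈) x).Kdiff) dOmegaY ∧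
      B9Thm314.Thm314LocalPrinted c35Y geo9Y (bg9Y (Matrix (Fin N) (Fin N) ℂ) (specialUnitaryUnits (Fin N))) (fun x => ((opsYNuOfRecordV4E N θ.toStage3Params Mstar 𝔯 (sectEYOfRecordV5 N θ.toStage3Params Mstar 𝔢₀) 𝔴 𝔈) x).Kdiff) OmKY dOmegaY :=
    thm314_pair_layerOfLetters (lettersYOfRecordV4 N θ.toStage3Params Mstar 𝔯) 𝔈 T14₁ T14₂ (fun x => locDataY x (E14₁ x) (X14₁ x) (M14₁ x) (diam14 x)) X14₂ M14₂
      (fun x => locDataY_laws x (E14₁ x) (near14₁ x) (first14₁ x) (chain14₁ x)) (fun x => locDataY_laws x (E14₂ x) (near14₂ x) (first14₂ x) (chain14₂ x)) r14 hr14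
      (fun x => modelSignsOn_geo9K x.toKIdx) (fun x y y' => dOmegaY_nonneg x y y') h14₁ h14₂ W14₁ W14₂ hW14₁ hW14₂ hcnt14₁ hcnt14₂ hexp14
  have hGp := hGp_opsYOfLetters_holds N θ.toStage3Params Mstar (lettersYOfRecordV4 N θ.toStage3Params Mstar 𝔯) 𝔈
  have hGA := hGA_opsYOfLetters N θ.toStage3Params Mstar (lettersYOfRecordV4 N θ.toStage3Params Mstar 𝔯) 𝔈
  obtain ⟨t39, hksum⟩ := t39_hksum_of_pins_opsYOfLetters θ.toStage3Params Mstar (lettersYOfRecordV4 N θ.toStage3Params Mstar 𝔯) 𝔈 𝔬39 rd39 α39 α' r39 δ39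
    θ39 B39 N39 a39 M39 h39α h39α1 hα'0 hα'1 hr39 hrδ39 hθ39 hB39 hN39 ha39 hM39 hst39 hloc39 h39 (fun _ => rfl) hblk39 hL39 hEK39
  have hsat : ∀ (x : MemberY θ.d₆ θ.ℓ₆ θ.hd' θ.hL' θ.b₀ θ.b₁ Mstar) (n : Fin 4) (B' δ' : ℝ),
      (∀ a a' b, RelB x.toKIdx a a' → maj342 (geo9Y x) n B' δ' a b = maj342 (geo9Y x) n B' δ' a' b) ∧
      (∀ a b b', RelB x.toKIdx b b' → maj342 (geo9Y x) n B' δ' a b = maj342 (geo9Y x) n B' δ' a b') :=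
    fun x n B' δ' => ⟨fun a a' b h => maj342_relB_left x.toKIdx n B' δ' a a' b h, fun a b b' h => maj342_relB_right x.toKIdx n B' δ' a b b' h⟩
  have hmult : ∀ (x : MemberY θ.d₆ θ.ℓ₆ θ.hd' θ.hL' θ.b₀ θ.b₁ Mstar) (y' : (geo9Y x).Site),
      (Finset.univ.filter (fun y'' : (geo9Y x).Site => RelB x.toKIdx y'' y')).card ≤ 2 * (θ.d₆ + 1) := fun x y' => by
    refine le_trans (Finset.card_le_card fun c hc => ?_) (card_sameCarrier_le_kIdx x.toKIdx y')
    exact Finset.mem_filter.2 ⟨@Finset.mem_univ _ (_) c, (Finset.mem_filter.1 hc).2⟩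
  have hRdist : ∀ (x : MemberY θ.d₆ θ.ℓ₆ θ.hd' θ.hL' θ.b₀ θ.b₁ Mstar) (a a' b : (geo9Y x).Site), RelB x.toKIdx a a' → (geo9Y x).dist a b = (geo9Y x).dist a' b :=
    fun x a a' b h => dist_eq_of_relB x.toKIdx h (relB_refl x.toKIdx b)
  have hRlen : ∀ (x : MemberY θ.d₆ θ.ℓ₆ θ.hd' θ.hL' θ.b₀ θ.b₁ Mstar) (a a' : (geo9Y x).Site), RelB x.toKIdx a a' → (geo9Y x).len a = (geo9Y x).len a' :=
    fun x a a' h => len_eq_of_relB x.toKIdx h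
  -- EVERY (3.42)∕(3.47) co-reading of rows 18–21 is a THEOREM on the coordinate models (`N06CoReadingsOfPins` over `B9CoReadingCoords(Glob∕S)`): five applications
  have hS := fun (x : MemberY θ.d₆ θ.ℓ₆ θ.hd' θ.hL' θ.b₀ θ.b₁ Mstar) (U : (bg9Y (Matrix (Fin N) (Fin N) ℂ) (specialUnitaryUnits (Fin N)) x).Cfg) => site_coReadings4_of_pins x.toKIdx bK (bg9Y (Matrix (Fin N) (Fin N) ℂ) (specialUnitaryUnits (Fin N)) x) (fun U => U) (lettersYOfRecordV4 N θ.toStage3Params Mstar 𝔯 x).Gp (lettersYOfRecordV4 N θ.toStage3Params Mstar 𝔯 x).parS U (hβI x) (hlev x) (hblkS x) (hblkYS x) (hGpS x U) (hDS x U) (hDsS x U) (hLapS x U)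
  have hco0 := fun x U => (hS x U).1; have hco1 := fun x U => (hS x U).2.1; have hco2 := fun x U => (hS x U).2.2.1; have hco3 := fun x U => (hS x U).2.2.2.1
  have hgl0 := fun x U => (hS x U).2.2.2.2.1; have hgl1 := fun x U => (hS x U).2.2.2.2.2.1; have hgl2 := fun x U => (hS x U).2.2.2.2.2.2.1; have hgl3 := fun x U => (hS x U).2.2.2.2.2.2.2
  have hA := fun (x : MemberY θ.d₆ θ.ℓ₆ θ.hd' θ.hL' θ.b₀ θ.b₁ Mstar) (U : (bg9Y (Matrix (Fin N) (Fin N) ℂ) (specialUnitaryUnits (Fin N)) x).Cfg) => bond_coReadings3_of_pins x.toKIdx bK (bg9Y (Matrix (Fin N) (Fin N) ℂ) (specialUnitaryUnits (Fin N)) x) (fun U => U) (lettersYOfRecordV4 N θ.toStage3Params Mstar 𝔯 x).GA (lettersYOfRecordV4 N θ.toStage3Params Mstar 𝔯 x).parB U (hβI x) (hlev x) (hblkA x) (hblkYA x) (hGcoA x U) (hDcoA x U) (hDscoA x U)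
  have hAL := fun (x : MemberY θ.d₆ θ.ℓ₆ θ.hd' θ.hL' θ.b₀ θ.b₁ Mstar) (U : (bg9Y (Matrix (Fin N) (Fin N) ℂ) (specialUnitaryUnits (Fin N)) x).Cfg) => bond_coReadingsLap_of_pins x.toKIdx bK (bg9Y (Matrix (Fin N) (Fin N) ℂ) (specialUnitaryUnits (Fin N)) x) (fun U => U) (lettersYOfRecordV4 N θ.toStage3Params Mstar 𝔯 x).GA (lettersYOfRecordV4 N θ.toStage3Params Mstar 𝔯 x).parB U (hβI x) (hlev x) (hblkA x) (hGcoA x U) (hLcoA x U)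
  have hcoA0 := fun x U => (hA x U).1; have hcoA1 := fun x U => (hA x U).2.1; have hcoA2 := fun x U => (hA x U).2.2.1; have hcoA3 := fun x U => (hAL x U).1
  have hglA0 := fun x U => (hA x U).2.2.2.2.2.2.1; have hglA1 := fun x U => (hA x U).2.2.2.2.2.2.2.1; have hglA2 := fun x U => (hA x U).2.2.2.2.2.2.2.2; have hglA3 := fun x U => (hAL x U).2.2
  letI hF : ∀ x : MemberY θ.d₆ θ.ℓ₆ θ.hd' θ.hL' θ.b₀ θ.b₁ Mstar, Fintype (B9GeoNormsKLevelV1.geo9K x.toKIdx).Site := fun x => (inferInstance : Fintype (geo9Y x).Site)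
  have hLA := fun (x : MemberY θ.d₆ θ.ℓ₆ θ.hd' θ.hL' θ.b₀ θ.b₁ Mstar) (U : (bg9Y (Matrix (Fin N) (Fin N) ℂ) (specialUnitaryUnits (Fin N)) x).Cfg) => bond_l2ReadsNbr3_of_pins x.toKIdx bK (bg9Y (Matrix (Fin N) (Fin N) ℂ) (specialUnitaryUnits (Fin N)) x) (fun U => U) (lettersYOfRecordV4 N θ.toStage3Params Mstar 𝔯 x).GA (lettersYOfRecordV4 N θ.toStage3Params Mstar 𝔯 x).parB U (R := (1 : ℝ)) (H := H x) (hβI x) (hβ1 x) (hblkA x) (hblkYA x) (hGcoA x U) (hDcoA x U) (hDscoA x U)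
  have hlA0 := fun x U => (hLA x U).1; have hlA1 := fun x U => (hLA x U).2.1; have hlA2 := fun x U => (hLA x U).2.2
  have hGD := fun (x : MemberY θ.d₆ θ.ℓ₆ θ.hd' θ.hL' θ.b₀ θ.b₁ Mstar) (U : (bg9Y (Matrix (Fin N) (Fin N) ℂ) (specialUnitaryUnits (Fin N)) x).Cfg) => bond_coReadings3_of_pins x.toKIdx bK (bg9Y (Matrix (Fin N) (Fin N) ℂ) (specialUnitaryUnits (Fin N)) x) (fun U => U) (lettersYOfRecordV4 N θ.toStage3Params Mstar 𝔯 x).GD (lettersYOfRecordV4 N θ.toStage3Params Mstar 𝔯 x).parB U (hβI x) (hlev x) (hblk12 x) (hblkY12 x) (hGco12 x U) (hDco12 x U) (hDsco12 x U)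
  have hG1 := fun (x : MemberY θ.d₆ θ.ℓ₆ θ.hd' θ.hL' θ.b₀ θ.b₁ Mstar) (U : (bg9Y (Matrix (Fin N) (Fin N) ℂ) (specialUnitaryUnits (Fin N)) x).Cfg) => bond_coReadings3_of_pins x.toKIdx bK (bg9Y (Matrix (Fin N) (Fin N) ℂ) (specialUnitaryUnits (Fin N)) x) (fun U => U) (lettersYOfRecordV4 N θ.toStage3Params Mstar 𝔯 x).G₁ (lettersYOfRecordV4 N θ.toStage3Params Mstar 𝔯 x).parB U (hβI x) (hlev x) (hblk12 x) (hblkY12 x) (hG1co12 x U) (hDco12 x U) (hDsco12 x U)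
  have hGG := fun (x : MemberY θ.d₆ θ.ℓ₆ θ.hd' θ.hL' θ.b₀ θ.b₁ Mstar) (U : (bg9Y (Matrix (Fin N) (Fin N) ℂ) (specialUnitaryUnits (Fin N)) x).Cfg) => bond_coReadings3_of_pins x.toKIdx bK (bg9Y (Matrix (Fin N) (Fin N) ℂ) (specialUnitaryUnits (Fin N)) x) (fun U => U) (lettersYOfRecordV4 N θ.toStage3Params Mstar 𝔯 x).GG (lettersYOfRecordV4 N θ.toStage3Params Mstar 𝔯 x).parB U (hβI x) (hlev x) (hblk12 x) (hblkY12 x) (hGGco12 x U) (hDco12 x U) (hDsco12 x U)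
  have hHH := fun (x : MemberY θ.d₆ θ.ℓ₆ θ.hd' θ.hL' θ.b₀ θ.b₁ Mstar) (U : (bg9Y (Matrix (Fin N) (Fin N) ℂ) (specialUnitaryUnits (Fin N)) x).Cfg) => coRealizesHRel_of_pins x.toKIdx bK (bg9Y (Matrix (Fin N) (Fin N) ℂ) (specialUnitaryUnits (Fin N)) x) (fun U => U) (lettersYOfRecordV4 N θ.toStage3Params Mstar 𝔯 x).H (lettersYOfRecordV4 N θ.toStage3Params Mstar 𝔯 x).parB U (hβI x) (hblk12 x) (hblkY12 x) (hblkZ12 x) (hHm12 x U) (hDco12 x U)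
  have hHH1 := fun (x : MemberY θ.d₆ θ.ℓ₆ θ.hd' θ.hL' θ.b₀ θ.b₁ Mstar) (U : (bg9Y (Matrix (Fin N) (Fin N) ℂ) (specialUnitaryUnits (Fin N)) x).Cfg) => coRealizesHRel_of_pins x.toKIdx bK (bg9Y (Matrix (Fin N) (Fin N) ℂ) (specialUnitaryUnits (Fin N)) x) (fun U => U) (lettersYOfRecordV4 N θ.toStage3Params Mstar 𝔯 x).H₁ (lettersYOfRecordV4 N θ.toStage3Params Mstar 𝔯 x).parB U (hβI x) (hblk12 x) (hblkY12 x) (hblkZ12 x) (hH1m12 x U) (hDco12 x U)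
  have hcoHR12 := fun (x : MemberY θ.d₆ θ.ℓ₆ θ.hd' θ.hL' θ.b₀ θ.b₁ Mstar) (U : (bg9Y (Matrix (Fin N) (Fin N) ℂ) (specialUnitaryUnits (Fin N)) x).Cfg) => And.intro (hHH x U).1 (And.intro (hHH x U).2 (And.intro (hHH1 x U).1 (hHH1 x U).2))
  have hcoR12 := fun (x : MemberY θ.d₆ θ.ℓ₆ θ.hd' θ.hL' θ.b₀ θ.b₁ Mstar) (U : (bg9Y (Matrix (Fin N) (Fin N) ℂ) (specialUnitaryUnits (Fin N)) x).Cfg) => And.intro (hGD x U).1 (And.intro (hGD x U).2.2.1 (And.intro (hG1 x U).1 (hG1 x U).2.2.1))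
  have hco1R12 := fun (x : MemberY θ.d₆ θ.ℓ₆ θ.hd' θ.hL' θ.b₀ θ.b₁ Mstar) (U : (bg9Y (Matrix (Fin N) (Fin N) ℂ) (specialUnitaryUnits (Fin N)) x).Cfg) => And.intro (hGD x U).2.1 (hG1 x U).2.1
  have hcoG12 := fun (x : MemberY θ.d₆ θ.ℓ₆ θ.hd' θ.hL' θ.b₀ θ.b₁ Mstar) (U : (bg9Y (Matrix (Fin N) (Fin N) ℂ) (specialUnitaryUnits (Fin N)) x).Cfg) => And.intro (hGD x U).2.2.2.1 (And.intro (hGD x U).2.2.2.2.1 (And.intro (hGD x U).2.2.2.2.2.1 (And.intro (hG1 x U).2.2.2.1 (And.intro (hG1 x U).2.2.2.2.1 (hG1 x U).2.2.2.2.2.1))))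
  have hcoR13 := fun (x : MemberY θ.d₆ θ.ℓ₆ θ.hd' θ.hL' θ.b₀ θ.b₁ Mstar) (U : (bg9Y (Matrix (Fin N) (Fin N) ℂ) (specialUnitaryUnits (Fin N)) x).Cfg) => And.intro (hGG x U).1 (hGG x U).2.2.1
  have hco1R13 := fun (x : MemberY θ.d₆ θ.ℓ₆ θ.hd' θ.hL' θ.b₀ θ.b₁ Mstar) (U : (bg9Y (Matrix (Fin N) (Fin N) ℂ) (specialUnitaryUnits (Fin N)) x).Cfg) => (hGG x U).2.1
  have hcoG13 := fun (x : MemberY θ.d₆ θ.ℓ₆ θ.hd' θ.hL' θ.b₀ θ.b₁ Mstar) (U : (bg9Y (Matrix (Fin N) (Fin N) ℂ) (specialUnitaryUnits (Fin N)) x).Cfg) => And.intro (hGG x U).2.2.2.1 (And.intro (hGG x U).2.2.2.2.1 (hGG x U).2.2.2.2.2.1)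
  have s3132 := s3132Nu_opsYNuOfRecordV4E θ.toStage3Params Mstar 𝔯 (sectEYOfRecordV5 N θ.toStage3Params Mstar 𝔢₀) 𝔴 𝔈 b26 hco26 hdec26 hco₁26 hdec₁26
  have s349 : B9.Stmt349Printed (θ.d₆ + 1) c35Y geo9Y (bg9Y (Matrix (Fin N) (Fin N) ℂ) (specialUnitaryUnits (Fin N))) (fun x => ((opsYNuOfRecordV4E N θ.toStage3Params Mstar 𝔯 (sectEYOfRecordV5 N θ.toStage3Params Mstar 𝔢₀) 𝔴 𝔈) x).P349) :=
    stmt349Printed_site_of_blockSchemas (lettersYOfRecordV4 N θ.toStage3Params Mstar 𝔯) h31S h32B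
  have hRd₂ : ∀ (x : MemberY θ.d₆ θ.ℓ₆ θ.hd' θ.hL' θ.b₀ θ.b₁ Mstar) (a b b' : (geo9Y x).Site), RelB x.toKIdx b b' → (geo9Y x).dist a b = (geo9Y x).dist a b' :=
    fun x a b b' h => dist_eq_of_relB x.toKIdx (relB_refl x.toKIdx a) h
  obtain ⟨t37', c38', t310', hsum'⟩ := rows131819_definite_geo9Y_pair (bg := bg9Y (Matrix (Fin N) (Fin N) ℂ) (specialUnitaryUnits (Fin N))) p q hp hq p3 q3 hp3 hq3 NQ hNQ0 c35Y_pos H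
    (fun x => RelB x.toKIdx) (2 * (θ.d₆ + 1)) mN (Real.sqrt ((θ.d₆ + 1) * Fintype.card κK)) (Real.sqrt_nonneg _) hRlen hRdist hRd₂ hmult hnbr 𝔬 rd 𝔭 𝔡 bH (fun x => ((opsYNuOfRecordV4E N θ.toStage3Params Mstar 𝔯 (sectEYOfRecordV5 N θ.toStage3Params Mstar 𝔢₀) 𝔴 𝔈) x).Gp) (fun x => evSK x.toKIdx) (fun x => evSK x.toKIdx) κ SH S3 SI S2 hst hκ hrd hloc h36 h36H
    hco0 hco1 hco2 hco3 hgl0 hgl1 hgl2 hgl3 hl0 hl1 hl2 hl3 hl4 hl5 hH1 hIR hsym htr hcntH hcnt3 hNQ hcntI hcnt2 𝔬A rdA 𝔭A 𝔡A bHA (fun x => ((opsYNuOfRecordV4E N θ.toStage3Params Mstar 𝔯 (sectEYOfRecordV5 N θ.toStage3Params Mstar 𝔢₀) 𝔴 𝔈) x).GA) (fun x => evBK x.toKIdx) (fun x => evBK x.toKIdx)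
    κA SHA S3A SIA S2A hstA hκA hrdA hlocA h36A h36HA hcoA0 hcoA1 hcoA2 hcoA3 hglA0 hglA1 hglA2 hglA3 hlA0 hlA1 hlA2 hlA3 hlA4 hlA5 hH1A hIRA hsymA htrA
    hcntHA hcnt3A hNQA hcntIA hcnt2A
  have h37f : (fun x => ((opsYNuOfRecordV4E N θ.toStage3Params Mstar 𝔯 (sectEYOfRecordV5 N θ.toStage3Params Mstar 𝔢₀) 𝔴 𝔈) x).E37) = fun x => E37YPair (bg := bg9Y (Matrix (Fin N) (Fin N) ℂ) (specialUnitaryUnits (Fin N))) (2 * (θ.d₆ + 1)) mN (Real.sqrt ((θ.d₆ + 1) * Fintype.card κK)) NQ p q p3 q3 (𝔬 x) (rd x) (H x)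
      ((opsYNuOfRecordV4E N θ.toStage3Params Mstar 𝔯 (sectEYOfRecordV5 N θ.toStage3Params Mstar 𝔢₀) 𝔴 𝔈) x).Gp := funext hE37
  have h310f : (fun x => ((opsYNuOfRecordV4E N θ.toStage3Params Mstar 𝔯 (sectEYOfRecordV5 N θ.toStage3Params Mstar 𝔢₀) 𝔴 𝔈) x).E310) = fun x => E310YPair (bg := bg9Y (Matrix (Fin N) (Fin N) ℂ) (specialUnitaryUnits (Fin N))) (2 * (θ.d₆ + 1)) mN (Real.sqrt ((θ.d₆ + 1) * Fintype.card κK)) NQ p q p3 q3 (𝔬A x) (rdA x) (H x)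
      ((opsYNuOfRecordV4E N θ.toStage3Params Mstar 𝔯 (sectEYOfRecordV5 N θ.toStage3Params Mstar 𝔢₀) 𝔴 𝔈) x).GA := funext hE310
  have t37 : B9.Thm37Printed c35Y geo9Y (bg9Y (Matrix (Fin N) (Fin N) ℂ) (specialUnitaryUnits (Fin N))) (fun x => ((opsYNuOfRecordV4E N θ.toStage3Params Mstar 𝔯 (sectEYOfRecordV5 N θ.toStage3Params Mstar 𝔢₀) 𝔴 𝔈) x).E37) := h37f ▸ t37'
  have c38 : B9.Cor38Printed c35Y geo9Y (bg9Y (Matrix (Fin N) (Fin N) ℂ) (specialUnitaryUnits (Fin N))) (fun x => ((opsYNuOfRecordV4E N θ.toStage3Params Mstar 𝔯 (sectEYOfRecordV5 N θ.toStage3Params Mstar 𝔢₀) 𝔴 𝔈) x).E37) := h37f ▸ c38'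
  have t310 : B9.Thm310Printed c35Y geo9Y (bg9Y (Matrix (Fin N) (Fin N) ℂ) (specialUnitaryUnits (Fin N))) (fun x => ((opsYNuOfRecordV4E N θ.toStage3Params Mstar 𝔯 (sectEYOfRecordV5 N θ.toStage3Params Mstar 𝔢₀) 𝔴 𝔈) x).E310) := h310f ▸ t310'
  have hsum : B9.RWSumsYieldIneqs geo9Y (bg9Y (Matrix (Fin N) (Fin N) ℂ) (specialUnitaryUnits (Fin N))) (fun x => ((opsYNuOfRecordV4E N θ.toStage3Params Mstar 𝔯 (sectEYOfRecordV5 N θ.toStage3Params Mstar 𝔢₀) 𝔴 𝔈) x).E37) (fun x => ((opsYNuOfRecordV4E N θ.toStage3Params Mstar 𝔯 (sectEYOfRecordV5 N θ.toStage3Params Mstar 𝔢₀) 𝔴 𝔈) x).E310)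
      (fun x => ((opsYNuOfRecordV4E N θ.toStage3Params Mstar 𝔯 (sectEYOfRecordV5 N θ.toStage3Params Mstar 𝔢₀) 𝔴 𝔈) x).Gp) (fun x => ((opsYNuOfRecordV4E N θ.toStage3Params Mstar 𝔯 (sectEYOfRecordV5 N θ.toStage3Params Mstar 𝔢₀) 𝔴 𝔈) x).GA) := by
    rw [h37f, h310f]; exact hsum'
  have h32 := B9.thm32_of_thm39 (θ.d₆ + 1) c35Y geo9Y (bg9Y (Matrix (Fin N) (Fin N) ℂ) (specialUnitaryUnits (Fin N))) (fun x => ((opsYNuOfRecordV4E N θ.toStage3Params Mstar 𝔯 (sectEYOfRecordV5 N θ.toStage3Params Mstar 𝔢₀) 𝔴 𝔈) x).EK39) (fun x => ((opsYNuOfRecordV4E N θ.toStage3Params Mstar 𝔯 (sectEYOfRecordV5 N θ.toStage3Params Mstar 𝔢₀) 𝔴 𝔈) x).Cinv) t39 hksum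
  have h33 := B9.thm33_of_thm37_310 c35Y geo9Y (bg9Y (Matrix (Fin N) (Fin N) ℂ) (specialUnitaryUnits (Fin N))) (fun x => ((opsYNuOfRecordV4E N θ.toStage3Params Mstar 𝔯 (sectEYOfRecordV5 N θ.toStage3Params Mstar 𝔢₀) 𝔴 𝔈) x).E37) (fun x => ((opsYNuOfRecordV4E N θ.toStage3Params Mstar 𝔯 (sectEYOfRecordV5 N θ.toStage3Params Mstar 𝔢₀) 𝔴 𝔈) x).E310) (fun x => ((opsYNuOfRecordV4E N θ.toStage3Params Mstar 𝔯 (sectEYOfRecordV5 N θ.toStage3Params Mstar 𝔢₀) 𝔴 𝔈) x).Gp)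
    (fun x => ((opsYNuOfRecordV4E N θ.toStage3Params Mstar 𝔯 (sectEYOfRecordV5 N θ.toStage3Params Mstar 𝔢₀) 𝔴 𝔈) x).GA) t37 t310 hsum
  have hB := hB_obligation_of_sectBFrame₄ θ.toStage3Params Mstar (opsYNuOfRecordV4E N θ.toStage3Params Mstar 𝔯 (sectEYOfRecordV5 N θ.toStage3Params Mstar 𝔢₀) 𝔴 𝔈) bB SB F hdB h32 h33
  have hgeoOK : ∀ x : MemberY θ.d₆ θ.ℓ₆ θ.hd' θ.hL' θ.b₀ θ.b₁ Mstar, GeoOK (geo9Y x) := fun x => ⟨geo9Y_dist_triangle x, geo9Y_dist_comm x, geo9K_dist_nonneg x.toKIdx, geo9Y_len_pos x⟩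
  obtain ⟨ML12, c12, hrow12⟩ := rowSum261_geo9Y (d := θ.d₆) (ℓ := θ.ℓ₆) (hd := θ.hd') (hL := θ.hL') (b₀ := θ.b₀) (b₁ := θ.b₁) (Mstar := Mstar) σ12 hσ12
  have hrow : ∀ x : MemberY θ.d₆ θ.ℓ₆ θ.hd' θ.hL' θ.b₀ θ.b₁ Mstar, ML12 ≤ (geo9Y x).M → RowSum (toB6 (geo9Y x) 1 (H12 x)) σ12 (max c12 0) := fun x hM y => (hrow12 x hM y).trans (le_max_left _ _)
  have hE : (fun x => ((opsYNuOfRecordV4E N θ.toStage3Params Mstar 𝔯 (sectEYOfRecordV5 N θ.toStage3Params Mstar 𝔢₀) 𝔴 𝔈) x).HasRWExp) = fun x => HasRWExpOfOps (𝔬12 x) := funext hpinE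
  have hH : (fun x => ((opsYNuOfRecordV4E N θ.toStage3Params Mstar 𝔯 (sectEYOfRecordV5 N θ.toStage3Params Mstar 𝔢₀) 𝔴 𝔈) x).HasRWExpH) = fun x => HasRWExpHOfOps (𝔬12 x) := funext hpinH
  have hK' : (fun x => ((opsYNuOfRecordV4E N θ.toStage3Params Mstar 𝔯 (sectEYOfRecordV5 N θ.toStage3Params Mstar 𝔢₀) 𝔴 𝔈) x).PosDefK) = fun x => PosDefKOfOps (𝔬12 x) := funext hpinK
  have hη : ∀ x : MemberY θ.d₆ θ.ℓ₆ θ.hd' θ.hL' θ.b₀ θ.b₁ Mstar, 0 < (geo9Y x).eta := fun x => (distOK_geo9Y x).eta_pos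
  have hL21 := lemma21AboveG_geo9Y (d := θ.d₆) (ℓ := θ.ℓ₆) (hd := θ.hd') (hL := θ.hL') (b₀ := θ.b₀) (b₁ := θ.b₁) (Mstar := Mstar) H12 hα12 (hα12'.trans_lt one_half_lt_one)
  have t312 : B9.Thm312Printed (θ.d₆ + 1) c35Y geo9Y (bg9Y (Matrix (Fin N) (Fin N) ℂ) (specialUnitaryUnits (Fin N))) (fun x => ((opsYNuOfRecordV4E N θ.toStage3Params Mstar 𝔯 (sectEYOfRecordV5 N θ.toStage3Params Mstar 𝔢₀) 𝔴 𝔈) x).GD) (fun x => ((opsYNuOfRecordV4E N θ.toStage3Params Mstar 𝔯 (sectEYOfRecordV5 N θ.toStage3Params Mstar 𝔢₀) 𝔴 𝔈) x).G₁)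
      (fun x => ((opsYNuOfRecordV4E N θ.toStage3Params Mstar 𝔯 (sectEYOfRecordV5 N θ.toStage3Params Mstar 𝔢₀) 𝔴 𝔈) x).H) (fun x => ((opsYNuOfRecordV4E N θ.toStage3Params Mstar 𝔯 (sectEYOfRecordV5 N θ.toStage3Params Mstar 𝔢₀) 𝔴 𝔈) x).H₁) (fun x => ((opsYNuOfRecordV4E N θ.toStage3Params Mstar 𝔯 (sectEYOfRecordV5 N θ.toStage3Params Mstar 𝔢₀) 𝔴 𝔈) x).HasRWExp) (fun x => ((opsYNuOfRecordV4E N θ.toStage3Params Mstar 𝔯 (sectEYOfRecordV5 N θ.toStage3Params Mstar 𝔢₀) 𝔴 𝔈) x).HasRWExpH)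
      (fun x => ((opsYNuOfRecordV4E N θ.toStage3Params Mstar 𝔯 (sectEYOfRecordV5 N θ.toStage3Params Mstar 𝔢₀) 𝔴 𝔈) x).PosDefK) := by
    rw [hE, hH, hK']
    exact thm312Printed_of_stepRelH 𝔬12 (fun _ => 1) H12 (fun x => ((opsYNuOfRecordV4E N θ.toStage3Params Mstar 𝔯 (sectEYOfRecordV5 N θ.toStage3Params Mstar 𝔢₀) 𝔴 𝔈) x).GD) (fun x => ((opsYNuOfRecordV4E N θ.toStage3Params Mstar 𝔯 (sectEYOfRecordV5 N θ.toStage3Params Mstar 𝔢₀) 𝔴 𝔈) x).G₁) (fun x => ((opsYNuOfRecordV4E N θ.toStage3Params Mstar 𝔯 (sectEYOfRecordV5 N θ.toStage3Params Mstar 𝔢₀) 𝔴 𝔈) x).H)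
      (fun x => ((opsYNuOfRecordV4E N θ.toStage3Params Mstar 𝔯 (sectEYOfRecordV5 N θ.toStage3Params Mstar 𝔢₀) 𝔴 𝔈) x).H₁) (fun x => evBK x.toKIdx) (fun x => evBK x.toKIdx) (fun x => RelB x.toKIdx) (2 * (θ.d₆ + 1)) θ12 θD12 r12 B12₀ δ12₀ δK12 σ12 (max c12 0) ρ12 a12 M12 ML12 B12₁ δ12₁ B12₃ δ12₃ α12
      ((θ.ℓ₆ + 1 : ℕ) : ℝ) Bβ12 Bε12 Bεβ12 hθ12 hθD12 hr12 hB12₀ hB12₃ hσ12.le hρ12 hρS12 hρδ12 hρ₃12 (le_max_right _ _) ha12 hM12 hδ12₁ hα12' hBβ12 hBε12 hBεβ12 hgeoOK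
      (fun x => modelSignsOn_geo9K x.toKIdx) (fun _ => hL1) (fun _ => le_rfl) hη hrow hL21 hsat hmult hRdist hRlen hcoR12 hco1R12 hcoHR12 hcoG12 hmodel12 hleft12 hlettersH12 hres12
  have t313 : B9.Thm313Printed c35Y geo9Y (bg9Y (Matrix (Fin N) (Fin N) ℂ) (specialUnitaryUnits (Fin N))) (fun x => ((opsYNuOfRecordV4E N θ.toStage3Params Mstar 𝔯 (sectEYOfRecordV5 N θ.toStage3Params Mstar 𝔢₀) 𝔴 𝔈) x).GG) (fun x => ((opsYNuOfRecordV4E N θ.toStage3Params Mstar 𝔯 (sectEYOfRecordV5 N θ.toStage3Params Mstar 𝔢₀) 𝔴 𝔈) x).HasRWExp) (fun x => ((opsYNuOfRecordV4E N θ.toStage3Params Mstar 𝔯 (sectEYOfRecordV5 N θ.toStage3Params Mstar 𝔢₀) 𝔴 𝔈) x).PosDefK) := by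
    rw [hE, hK']
    exact thm313Printed_of_stepRel 𝔬12 (fun _ => 1) H12 (fun x => ((opsYNuOfRecordV4E N θ.toStage3Params Mstar 𝔯 (sectEYOfRecordV5 N θ.toStage3Params Mstar 𝔢₀) 𝔴 𝔈) x).GG) bH13 (fun x => evBK x.toKIdx) (fun x => evBK x.toKIdx) (fun x => RelB x.toKIdx) (2 * (θ.d₆ + 1)) θ12 θD12 r12 B12₀ δ12₀ δK12 σ12 (max c12 0) ρ12 a12 M12 ML12
      B12₁ δ12₁ B12₃ δ12₃ ρ13 α12 ((θ.ℓ₆ + 1 : ℕ) : ℝ) κ13 Bβ12 Bε12 Bεβ12 hθ12 hθD12 hr12 hB12₀ hB12₃ hσ12.le hρ13 hρ13ρ hρS12 (le_trans (by linarith only [hσ12]) hρ₃12) hρδ12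
      (le_max_right _ _) ha12 hM12 hδ12₁ hBβ12 hBε12 hBεβ12 hgeoOK (fun x => modelSignsOn_geo9K x.toKIdx) (fun _ => hL1) (fun _ => le_rfl) hη hκ13 hrow hL21 hsat hmult hcoR13 hco1R13 hcoG13
      hmodel12 hleft12 hletters13 hlettersD13 hres13
  have hE4 := hE4_of_hGA_e4 (opsYNuOfRecordV4E N θ.toStage3Params Mstar 𝔯 (sectEYOfRecordV5 N θ.toStage3Params Mstar 𝔢₀) 𝔴 𝔈) (hGA_e4_opsYOfLetters N θ.toStage3Params Mstar (lettersYOfRecordV4 N θ.toStage3Params Mstar 𝔯) 𝔈)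
  have hH2 := hH2_of_hGA_h2 (opsYNuOfRecordV4E N θ.toStage3Params Mstar 𝔯 (sectEYOfRecordV5 N θ.toStage3Params Mstar 𝔢₀) 𝔴 𝔈) (hGA_h2_opsYOfLetters N θ.toStage3Params Mstar (lettersYOfRecordV4 N θ.toStage3Params Mstar 𝔯) 𝔈)
  have hg := hg_obligation_vacuous θ.toStage3Params Mstar (opsYNuOfRecordV4E N θ.toStage3Params Mstar 𝔯 (sectEYOfRecordV5 N θ.toStage3Params Mstar 𝔢₀) 𝔴 𝔈)
  exact b9_main_of_up_view₁₁B10YZW_of_obligations θ hθ Mstar (opsYNuOfRecordV4E N θ.toStage3Params Mstar 𝔯 (sectEYOfRecordV5 N θ.toStage3Params Mstar 𝔢₀) 𝔴 𝔈) ζ lamW w hup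
    (hGp_e_opsYOfLetters N θ.toStage3Params Mstar (lettersYOfRecordV4 N θ.toStage3Params Mstar 𝔯) 𝔈) (hGp_h1_opsYOfLetters N θ.toStage3Params Mstar (lettersYOfRecordV4 N θ.toStage3Params Mstar 𝔯) 𝔈)
    (hC_opsYOfLetters N θ.toStage3Params Mstar (lettersYOfRecordV4 N θ.toStage3Params Mstar 𝔯) 𝔈) (hGA_e_opsYOfLetters N θ.toStage3Params Mstar (lettersYOfRecordV4 N θ.toStage3Params Mstar 𝔯) 𝔈)
    (hGA_h1_opsYOfLetters N θ.toStage3Params Mstar (lettersYOfRecordV4 N θ.toStage3Params Mstar 𝔯) 𝔈) (hGA_e4_opsYOfLetters N θ.toStage3Params Mstar (lettersYOfRecordV4 N θ.toStage3Params Mstar 𝔯) 𝔈)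
    (hGA_h2_opsYOfLetters N θ.toStage3Params Mstar (lettersYOfRecordV4 N θ.toStage3Params Mstar 𝔯) 𝔈) (hGA_l2_opsYOfLetters N θ.toStage3Params Mstar (lettersYOfRecordV4 N θ.toStage3Params Mstar 𝔯) 𝔈)
    hE4 hH2 hGp hGA hB hg t37 c38 t39 t310 hsum hksum t311 t312 t313 t314 t315 s349 s3132 t314loc P

end Pointed

end Summit.QuantumFields.YangMills.BalabanUVNodes.N06AtOpsYNuOfRecordV5EPair

end
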